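import Literature.NumberTheory.LFunctions.FordLemma51
import Literature.NumberTheory.LFunctions.FordVinogradovToolkit
import Literature.NumberTheory.LFunctions.FordRoughNumbers
import HarnessLib

/-!
# Ford's Theorem 2 for large `λ`: the core of §5 (one `λ`-interval from Theorems 3–4 and a
# certified parameter row)

Topic `Literature/NumberTheory/LFunctions`. Everything in this file is PROVED; no named fact is
introduced (the only `def` is the regime minorant `FordVK.ellMin` of (5.11)–(5.12)).

K. Ford, *Vinogradov's integral and bounds for the Riemann zeta function*, Proc. London Math.
Soc. (3) 85 (2002), 565–633 (arXiv:1910.08209, whose numbering is used), §5: Theorem 2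
(`S(N,t) ≤ 9.463 N^{1−1/(133.66λ²)}`, `λ = log t/log N`) for `λ ≥ 87` is deduced from Lemma 5.1
(the tree's `FordVK.ford_lemma51`, `FordLemma51.lean`) with `M₁ = N^{μ₁}`, `M₂ = N^{μ₂}`,
`μ₁ = 0.1905`, `μ₂ = 0.1603`, `ℬ = 𝒞(M₂, M₂^η)` (`FordVK.calC`, `FordRoughNumbers.lean`), using
Theorem 3 (through (5.14), a row `(ρ, θ)` of (1.7)) for `J_{r,k}(⌊M₁⌋)`, Theorem 4 (5.17) for
the incomplete system `J_{s,g,h}(ℬ)`, Lemma 2.2 (5.19) for `M₂/|ℬ|`, the bound (5.10)–(5.12) for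
`W_h ⋯ W_g`, and finally a choice of the integer parameters on each small `λ`-interval with a
numerical verification of the constant and of the exponent (Lemma 5.2 for `λ ≥ 220` analytically,
Lemma 5.3 for `87 ≤ λ ≤ 220` by "Program 2"). This file proves that deduction with Theorems 3 and
4 as displayed hypotheses (they are §§3–4 of the source and not yet in the tree; D-0026: they are
NOT vendored as named facts here) and with the numerical verification isolated as a list of
real inequalities in the rational data of a parameter row (to be discharged by a kernel interval
checker, as for Table 6.1 in `FordRowCheck.lean`):

* `FordVK.Wj_le` — (5.7)–(5.11): `W_j ≤ 16 g 4^g s · M₂^j N^{−ℓ_j}` for any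
  `ℓ_j ≤ min(jμ₂, j − λ, λ − j(1−μ₁−μ₂))` (with `M = ⌊M₁⌋ ≥ M₁/2` in place of the source's silent
  `M = M₁` in the third summand of `W_j`);
* `FordVK.sec5_core` — the display before (5.22): from `M₂ ≤ C₃|ℬ|`,
  `J_{r,k}(M) ≤ C₁ M^{2r−k(k+1)/2+X₁}`, `J_{s,k,[h,g]}(ℬ) ≤ C₂ M₂^{2s−τ(h+g)/2+E₂}` and the `ℓ_j`,
  `S ≤ 2M₁M₂ + t(M₁M₂)^{k+1}/((k+1)N^k) + C₃^{1/r}(C₁C₂(5r)^k(16g4^gs)^τ)^{1/(2rs)} N^{1+(μ₁X₁+μ₂E₂−∑ℓ_j)/(2rs)}`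
  (logarithmic bookkeeping of the six factors of `FordVK.ford_lemma51`);
* `FordVK.ellMin`, `ellMin_le`, `sum_ellMin_eq` — the minorants of (5.11) in the three regimes
  `j ≤ m₂`, `m₂ < j ≤ m₁`, `j > m₁` (`m_i = ⌊λ/(1−μ_i)⌋`) and their sum `Z₀ + Z₁λ` in closed form
  ((5.12); the proof of Lemma 5.3 uses exactly this `H = Z₀ + Z₁λ`);
* `FordVK.J_row_bound` — (5.14) from a row of (1.7) (`J_{r,k} ≤ M^{2(r−s₃)} J_{s₃,k}`,
  `VMV.J_add_le`); `FordVK.M₂_le_C₃_card` — (5.19) from `FordVK.card_calC_ge_26` (with any integer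
  `w⁺ ≥ 26u/25` in place of `w = ⌊26u/25⌋`); `FordVK.Jinc_eq_of_le`; `FordVK.log_factorial_le`
  (`log n! ≤ (n+1)log(n+1) − n`); `FordVK.log_le_mul_of_ge` (`log N ≤ N^{E₃}`, (5.19));
* `FordVK.sec5_interval` — **Theorem 2 on one `λ`-interval `[λ_lo, λ_hi]` (`λ_lo ≥ 87`) in the
  nontrivial range `log N ≥ 300λ²`**: for fixed integers `k, h, g, s, m₁, m₂, w⁺`, a row
  `(ρ, θ)` of (1.7) at `k` (hypothesis `hT3`), Theorem 4 (hypothesis `hT4`, verbatim), and the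
  certificate conditions `c0`–`c9` (rational side conditions, (1.10), the constant and the exponent
  at both endpoints), `S ≤ C N^{1 − (log N)²/(133.66 (log t)²)}`;
* `FordVK.expSum_bound_trivial_range` — the range `log N ≤ 300λ²`:
  `S ≤ N ≤ 9.44 N^{1 − (log N)²/(133.66 (log t)²)}` ((5.15)).

Deviations from the printed proof, all on the safe side and documented at the lemmas: Lemma 2.2 in
the Chebyshev-strength form of `FordRoughNumbers.lean` (`(7δ/8)^w`), `(w+1)! ≤ (w+2)^{w+2}e^{−w−1}`,
the constant `16g4^gs` per `W_j` instead of `2^{g+1}` (all three are `e^{O(g²)}` and enter through a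
`2rs ≍ 0.34λ⁴`-th root), and `T₂ ≤ N^{1−1.9·10⁻⁶}/(k+1)` from `k ≥ (λ_hi − 0.6492)/0.6492`.

## References

* K. Ford, Proc. London Math. Soc. (3) 85 (2002), 565–633; arXiv:1910.08209: §5, Lemma 5.1,
  (5.7)–(5.22), Lemmas 5.2–5.3 and their proofs, (1.7), Theorem 4, Lemma 2.2. [Ford2002]
-/

noncomputable section

open Finset Real

namespace Literature.NumberTheory.LFunctions
namespace FordVK

open VMV

/-! ### The factor `W_j` (Ford (5.7)–(5.11)) -/

/-- **Bound for `W_j`.** With `t = N^λ`, `M₁ = N^{μ₁}`, `M₂ = N^{μ₂}`, `M = ⌊M₁⌋ ≥ M₁/2`,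
`M₂ ≤ M`, `s ≤ r`, `1 ≤ j ≤ g` and a real `ℓ ≤ min(jμ₂, j − λ, λ − j(1−μ₁−μ₂))`:
`W_j ≤ 16 g 4^g s · M₂^j N^{−ℓ}`. [cite: Ford2002, (5.7)–(5.11)] -/
theorem Wj_le {s r N M g j : ℕ} {M₁ M₂ t lam μ₁ μ₂ ℓ : ℝ} (hs : 1 ≤ s) (hr : 1 ≤ r) (hsr : s ≤ r)
    (hN : 2 ≤ N) (hj : 1 ≤ j) (hjg : j ≤ g) (hM₁ : 1 ≤ M₁) (hM : M = ⌊M₁⌋₊) (hM₂M : M₂ ≤ M)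
    (hM₂ : M₂ = (N : ℝ) ^ μ₂) (hM₁' : M₁ = (N : ℝ) ^ μ₁) (ht : t = (N : ℝ) ^ lam)
    (hℓ1 : ℓ ≤ j * μ₂) (hℓ2 : ℓ ≤ j - lam) (hℓ3 : ℓ ≤ lam - j * (1 - μ₁ - μ₂)) :
    Wj s r N M M₂ t j ≤ 16 * g * 4 ^ g * s * (M₂ ^ j * (N : ℝ) ^ (-ℓ)) := by
  have hN0 : (0 : ℝ) < N := by positivity
  have hN1 : (1 : ℝ) ≤ N := by exact_mod_cast (by omega : 1 ≤ N)
  have hM1 : 1 ≤ M := by rw [hM]; exact Nat.le_floor (by simpa using hM₁)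
  have hM0 : (0 : ℝ) < M := by exact_mod_cast hM1
  have hM₁M : M₁ ≤ 2 * M := by
    have := Nat.lt_floor_add_one M₁
    have h1 : (1 : ℝ) ≤ M := by exact_mod_cast hM1
    rw [← hM] at this
    linarith
  have hM₁0 : 0 < M₁ := by linarith
  have hM₂0 : 0 < M₂ := by rw [hM₂]; positivity
  have ht0 : 0 < t := by rw [ht]; positivity
  have hs0 : (1 : ℝ) ≤ s := by exact_mod_cast hs
  have hr0 : (0 : ℝ) < r := by exact_mod_cast hr
  have hsr' : (s : ℝ) ≤ r := by exact_mod_cast hsr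
  have hj0 : (1 : ℝ) ≤ j := by exact_mod_cast hj
  have hg1 : (1 : ℝ) ≤ g := by exact_mod_cast (hj.trans hjg)
  -- the target `T = M₂^j N^{-ℓ}` dominates `1`, `M₂^j t/N^j` and `N^j/(t M₁^j)`
  set T : ℝ := M₂ ^ j * (N : ℝ) ^ (-ℓ) with hT
  have hM₂j : M₂ ^ j = (N : ℝ) ^ ((j : ℝ) * μ₂) := by
    rw [hM₂, ← Real.rpow_natCast, ← Real.rpow_mul hN0.le]; ring_nf
  have hTexp : T = (N : ℝ) ^ ((j : ℝ) * μ₂ - ℓ) := by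
    rw [hT, hM₂j, ← Real.rpow_add hN0]; ring_nf
  have hT0 : 0 < T := by positivity
  have h1T : 1 ≤ T := by
    rw [hTexp]; exact Real.one_le_rpow hN1 (by linarith)
  have h2T : M₂ ^ j * t / (N : ℝ) ^ j ≤ T := by
    rw [mul_div_assoc, hT]
    refine mul_le_mul_of_nonneg_left ?_ (by positivity)
    rw [ht, ← Real.rpow_natCast, ← Real.rpow_sub hN0]
    exact Real.rpow_le_rpow_of_exponent_le hN1 (by linarith)
  have h3T : (N : ℝ) ^ j / (t * M₁ ^ j) ≤ T := by
    rw [hTexp, ht, hM₁', ← Real.rpow_natCast, ← Real.rpow_natCast, ← Real.rpow_mul hN0.le,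
      ← Real.rpow_add hN0, ← Real.rpow_sub hN0]
    exact Real.rpow_le_rpow_of_exponent_le hN1 (by nlinarith)
  -- the four summands of the second branch of `W_j`
  have hA1 : 2 * s * M₂ ^ j / (r * (M : ℝ) ^ j) ≤ 2 * T := by
    have h1 : M₂ ^ j ≤ (M : ℝ) ^ j := pow_le_pow_left₀ hM₂0.le hM₂M j
    have hMj : (0 : ℝ) < (M : ℝ) ^ j := by positivity
    rw [div_le_iff₀ (by positivity)]
    have h2 : (s : ℝ) * M₂ ^ j ≤ r * (M : ℝ) ^ j := mul_le_mul hsr' h1 (by positivity) hr0.le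
    have h3 : (r : ℝ) * (M : ℝ) ^ j ≤ T * (r * (M : ℝ) ^ j) := by
      have : 0 ≤ (r : ℝ) * (M : ℝ) ^ j := by positivity
      nlinarith
    nlinarith
  have hA2 : s * t * M₂ ^ j / (π * j * (N : ℝ) ^ j) ≤ s * T := by
    have hπj : 1 ≤ π * j := by nlinarith [Real.pi_gt_three]
    calc s * t * M₂ ^ j / (π * j * (N : ℝ) ^ j) = (s * (M₂ ^ j * t / (N : ℝ) ^ j)) / (π * j) := by
          field_simp
      _ ≤ s * (M₂ ^ j * t / (N : ℝ) ^ j) := div_le_self (by positivity) hπj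
      _ ≤ s * T := mul_le_mul_of_nonneg_left h2T (by positivity)
  have hA3 : 4 * π * j * (2 * (N : ℝ)) ^ j / (r * t * (M : ℝ) ^ j) ≤ 13 * g * 4 ^ g * T := by
    -- `1/M^j ≤ (2/M₁)^j`
    have hMj : M₁ ^ j ≤ (2 * (M : ℝ)) ^ j := pow_le_pow_left₀ hM₁0.le hM₁M j
    have h4 : 4 * π * j ≤ 13 * g := by nlinarith [Real.pi_lt_d2, (show (j:ℝ) ≤ g by exact_mod_cast hjg)]
    have hpow : (4 : ℝ) ^ j ≤ 4 ^ g := pow_le_pow_right₀ (by norm_num) hjg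
    calc 4 * π * j * (2 * (N : ℝ)) ^ j / (r * t * (M : ℝ) ^ j)
        = (4 * π * j) * ((2 : ℝ) ^ j * (N : ℝ) ^ j) / (r * t * (M : ℝ) ^ j) := by rw [mul_pow]
      _ ≤ (4 * π * j) * ((2 : ℝ) ^ j * (N : ℝ) ^ j) / (1 * t * (M : ℝ) ^ j) := by
          refine div_le_div_of_nonneg_left (by positivity) (by positivity) ?_
          exact mul_le_mul_of_nonneg_right (mul_le_mul_of_nonneg_right (by exact_mod_cast hr) ht0.le)
            (by positivity)
      _ = (4 * π * j) * (4 : ℝ) ^ j * ((N : ℝ) ^ j / (t * (2 * (M : ℝ)) ^ j)) := by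
          rw [mul_pow, show (4 : ℝ) ^ j = 2 ^ j * 2 ^ j by rw [← mul_pow]; norm_num]
          field_simp
      _ ≤ (4 * π * j) * (4 : ℝ) ^ j * ((N : ℝ) ^ j / (t * M₁ ^ j)) := by
          refine mul_le_mul_of_nonneg_left ?_ (by positivity)
          exact div_le_div_of_nonneg_left (by positivity) (by positivity)
            (mul_le_mul_of_nonneg_left hMj ht0.le)
      _ ≤ (13 * g) * (4 : ℝ) ^ g * T := by
          refine mul_le_mul (mul_le_mul h4 hpow (by positivity) (by positivity)) h3T (by positivity)
            (by positivity)
      _ = 13 * g * 4 ^ g * T := by ring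
  have hsum : 2 * s * M₂ ^ j / (r * (M : ℝ) ^ j) + s * t * M₂ ^ j / (π * j * (N : ℝ) ^ j)
      + 4 * π * j * (2 * (N : ℝ)) ^ j / (r * t * (M : ℝ) ^ j) + 2 ≤ 16 * g * 4 ^ g * s * T := by
    have h4g : (4 : ℝ) ≤ 4 ^ g := by
      calc (4 : ℝ) = 4 ^ 1 := by norm_num
        _ ≤ 4 ^ g := pow_le_pow_right₀ (by norm_num) (hj.trans hjg)
    set X : ℝ := g * 4 ^ g * s with hX
    have hg4 : (4 : ℝ) ≤ g * 4 ^ g :=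
      calc (4 : ℝ) = 1 * 4 := by norm_num
        _ ≤ g * 4 ^ g := mul_le_mul hg1 h4g (by norm_num) (by positivity)
    have hX4 : (4 : ℝ) ≤ X :=
      calc (4 : ℝ) = 4 * 1 := by norm_num
        _ ≤ g * 4 ^ g * s := mul_le_mul hg4 hs0 (by norm_num) (by positivity)
    have hsX : (s : ℝ) ≤ X := le_mul_of_one_le_left (by positivity) (by linarith)
    have hgX : (g : ℝ) * 4 ^ g ≤ X := le_mul_of_one_le_right (by positivity) hs0
    have f2 : 13 * g * 4 ^ g * T ≤ 13 * X * T := by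
      have := mul_le_mul_of_nonneg_right hgX hT0.le
      linarith
    have f3 : s * T ≤ X * T := mul_le_mul_of_nonneg_right hsX hT0.le
    have f4 : 4 * T ≤ X * T := mul_le_mul_of_nonneg_right hX4 hT0.le
    have : 16 * (g : ℝ) * 4 ^ g * s * T = 16 * X * T := by rw [hX]; ring
    rw [this]
    linarith [hA1, hA2, hA3, h1T]
  calc Wj s r N M M₂ t j ≤ _ := min_le_right _ _
    _ ≤ _ := hsum

/-! ### Re-indexing the products and sums over the exponents `h ≤ j ≤ g` -/

/-- The indicator product over `Fin k` used in `FordVK.ford_lemma51` is the product over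
`j ∈ [h, g]` (`1 ≤ h`, `g ≤ k`). [folklore] -/
theorem prod_fin_indicator_eq {k h g : ℕ} (hh : 1 ≤ h) (hgk : g ≤ k) (f : ℕ → ℝ) :
    (∏ j : Fin k, if h ≤ j.val + 1 ∧ j.val + 1 ≤ g then f (j.val + 1) else 1)
      = ∏ m ∈ Finset.Icc h g, f m := by
  rw [Fin.prod_univ_eq_prod_range (fun i => if h ≤ i + 1 ∧ i + 1 ≤ g then f (i + 1) else 1) k,
    ← Finset.prod_filter]
  refine Finset.prod_nbij' (fun i => i + 1) (fun m => m - 1) ?_ ?_ ?_ ?_ ?_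
  · intro a ha
    simp only [Finset.mem_filter, Finset.mem_range] at ha
    simp only [Finset.mem_Icc]; omega
  · intro b hb
    simp only [Finset.mem_Icc] at hb
    simp only [Finset.mem_filter, Finset.mem_range]; omega
  · intro a ha; simp
  · intro b hb
    simp only [Finset.mem_Icc] at hb
    show b - 1 + 1 = b; omega
  · intro a ha; rfl

/-- The same for sums. [folklore] -/
theorem sum_fin_indicator_eq {k h g : ℕ} (hh : 1 ≤ h) (hgk : g ≤ k) (f : ℕ → ℝ) :
    (∑ j : Fin k, if h ≤ j.val + 1 ∧ j.val + 1 ≤ g then f (j.val + 1) else 0)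
      = ∑ m ∈ Finset.Icc h g, f m := by
  rw [Fin.sum_univ_eq_sum_range (fun i => if h ≤ i + 1 ∧ i + 1 ≤ g then f (i + 1) else 0) k,
    ← Finset.sum_filter]
  refine Finset.sum_nbij' (fun i => i + 1) (fun m => m - 1) ?_ ?_ ?_ ?_ ?_
  · intro a ha
    simp only [Finset.mem_filter, Finset.mem_range] at ha
    simp only [Finset.mem_Icc]; omega
  · intro b hb
    simp only [Finset.mem_Icc] at hb
    simp only [Finset.mem_filter, Finset.mem_range]; omega
  · intro a ha; simp
  · intro b hb
    simp only [Finset.mem_Icc] at hb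
    show b - 1 + 1 = b; omega
  · intro a ha; rfl

/-- `∑_{j<k} (j+1) = k(k+1)/2`. [folklore] -/
theorem sum_range_succ_eq (k : ℕ) : ∑ i ∈ Finset.range k, (i + 1) = k * (k + 1) / 2 := by
  have h1 : (∑ i ∈ Finset.range k, (i + 1)) * 2 = k * (k + 1) := by
    rw [Finset.sum_add_distrib, Finset.sum_const, Finset.card_range, smul_eq_mul, mul_one, add_mul,
      Finset.sum_range_id_mul_two]
    rcases k with _ | k
    · simp
    · simp; ring
  omega

/-- `∏_{j<k} 5 r M^{j+1} = (5r)^k M^{k(k+1)/2}`. [cite: Ford2002, Lemma 5.1 ("multiply out")] -/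
theorem prod_five_r_pow (k r : ℕ) (M : ℝ) :
    (∏ j : Fin k, (5 : ℝ) * (r * M ^ (j.val + 1))) = (5 * r) ^ k * M ^ (k * (k + 1) / 2) := by
  rw [Fin.prod_univ_eq_prod_range (fun i => (5 : ℝ) * (r * M ^ (i + 1))) k]
  simp_rw [← mul_assoc]
  rw [Finset.prod_mul_distrib, Finset.prod_const, Finset.card_range, Finset.prod_pow_eq_pow_sum,
    sum_range_succ_eq]

/-- `∑_{j=h}^{g} j = (g-h+1)(h+g)/2` (real form, `h ≤ g + 1`). [folklore] -/
theorem sum_Icc_cast_eq {h g : ℕ} (hhg : h ≤ g + 1) :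
    ∑ j ∈ Finset.Icc h g, (j : ℝ) = ((g : ℝ) - h + 1) * (h + g) / 2 := by
  rw [← Finset.Ico_add_one_right_eq_Icc, Finset.sum_Ico_eq_sum_range]
  have hτ : ((g + 1 - h : ℕ) : ℝ) = (g : ℝ) - h + 1 := by
    rw [Nat.cast_sub hhg]; push_cast; ring
  have h2 := Finset.sum_range_id_mul_two (g + 1 - h)
  have h2' : (∑ i ∈ Finset.range (g + 1 - h), (i : ℝ)) * 2 = ((g + 1 - h : ℕ) : ℝ) * ((g + 1 - h : ℕ) - 1 : ℝ) := by
    have : ((g + 1 - h : ℕ) : ℝ) * ((g + 1 - h : ℕ) - 1 : ℝ) = (((g + 1 - h) * (g + 1 - h - 1) : ℕ) : ℝ) := by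
      rcases Nat.eq_zero_or_pos (g + 1 - h) with h0 | hpos
      · rw [h0]; simp
      · rw [Nat.cast_mul, Nat.cast_sub hpos]; simp
    rw [this, ← h2]; push_cast; ring
  push_cast
  rw [Finset.sum_add_distrib, Finset.sum_const, Finset.card_range, nsmul_eq_mul, hτ]
  rw [hτ] at h2'
  linarith

/-- `W_j > 0`. [folklore] -/
theorem Wj_pos {s r N M j : ℕ} {M₂ t : ℝ} (hs : 1 ≤ s) (hM₂ : 0 < M₂) (ht : 0 ≤ t) :
    0 < Wj s r N M M₂ t j := by
  unfold Wj
  refine lt_min (by positivity) ?_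
  have h1 : 0 ≤ 2 * (s : ℝ) * M₂ ^ j / (r * (M : ℝ) ^ j) := by positivity
  have h2 : 0 ≤ (s : ℝ) * t * M₂ ^ j / (π * j * (N : ℝ) ^ j) := by positivity
  have h3 : 0 ≤ 4 * π * j * (2 * (N : ℝ)) ^ j / (r * t * (M : ℝ) ^ j) := by positivity
  linarith

/-- `J_{s,k,[h,g]}(ℬ) ≥ 1` for nonempty `ℬ` (the diagonal solution). [folklore] -/
theorem one_le_Jinc (k s : ℕ) {B : Finset ℤ} (hB : B.Nonempty) (h g : ℕ) : 1 ≤ Jinc k s B h g := by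
  classical
  obtain ⟨b, hb⟩ := hB
  rw [Jinc_eq_card]
  refine Finset.card_pos.2 ⟨(fun _ => b, fun _ => b), ?_⟩
  rw [Finset.mem_filter, Finset.mem_product]
  exact ⟨⟨mem_tuples.2 fun _ => hb, mem_tuples.2 fun _ => hb⟩, fun _ _ _ => rfl⟩

/-! ### The core deduction of §5 -/

/-- **Ford §5, (5.7)–(5.22): the main term of Lemma 5.1 as a power of `N`.** Notation:
`t = N^λ`, `M₁ = N^{μ₁}`, `M₂ = N^{μ₂}`, `M = ⌊M₁⌋`, `τ = g − h + 1`, `ℬ ⊆ [1, M₂]` nonempty with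
`M₂ ≤ C₃|ℬ|` (Lemma 2.2), `J_{r,k}(M) ≤ C₁ M^{2r − k(k+1)/2 + X₁}` (Theorem 3, (5.14)),
`J_{s,k,[h,g]}(ℬ) ≤ C₂ M₂^{2s − τ(h+g)/2 + E₂}` (Theorem 4, (5.17)), and reals
`ℓ_j ≤ min(jμ₂, j − λ, λ − j(1 − μ₁ − μ₂))` (`h ≤ j ≤ g`, (5.11)). Then

  `S ≤ 2M₁M₂ + t(M₁M₂)^{k+1}/((k+1)N^k)`
  `   + C₃^{1/r} (C₁ C₂ (5r)^k (16 g 4^g s)^τ)^{1/(2rs)} · N^{1 + (μ₁X₁ + μ₂E₂ − ∑_j ℓ_j)/(2rs)}`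

(the display before (5.22), with the constants of `FordVK.Wj_le` in place of `2^{g²}`).
[cite: Ford2002, §5, (5.10)–(5.22)] -/
theorem sec5_core {k r s h g N R₀ : ℕ} {t u lam μ₁ μ₂ C₁ C₂ C₃ E₂ X₁ : ℝ} (ℓ : ℕ → ℝ)
    (B : Finset ℕ) (hN : 2 ≤ N) (hNR : N < R₀) (hR : R₀ ≤ 2 * N) (hu0 : 0 < u) (hu1 : u ≤ 1)
    (ht : t = (N : ℝ) ^ lam) (hμ₁ : 0 < μ₁) (hμ₂ : 0 < μ₂) (hμ : μ₁ + μ₂ ≤ 1)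
    (hr : 1 ≤ r) (hs : 1 ≤ s) (hsr : s ≤ r) (hh : 1 ≤ h) (hhg : h ≤ g) (hgk : g ≤ k)
    (hM₂M : (N : ℝ) ^ μ₂ ≤ ⌊(N : ℝ) ^ μ₁⌋₊)
    (hBne : B.Nonempty) (hBB : ∀ b ∈ B, 1 ≤ b ∧ (b : ℝ) ≤ (N : ℝ) ^ μ₂)
    (hC₁ : 0 < C₁) (hC₂ : 0 < C₂) (hC₃ : 0 < C₃) (hX₁ : 0 ≤ X₁)
    (hB : (N : ℝ) ^ μ₂ ≤ C₃ * B.card)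
    (hJ : (J k r (Finset.Icc (1 : ℤ) ⌊(N : ℝ) ^ μ₁⌋₊) : ℝ)
      ≤ C₁ * ((⌊(N : ℝ) ^ μ₁⌋₊ : ℕ) : ℝ) ^ ((2 * r : ℝ) - ((k * (k + 1) / 2 : ℕ) : ℝ) + X₁))
    (hJinc : (Jinc k s (B.map Nat.castEmbedding) h g : ℝ)
      ≤ C₂ * ((N : ℝ) ^ μ₂) ^ ((2 * s : ℝ) - ((g : ℝ) - h + 1) * ((h : ℝ) + g) / 2 + E₂))
    (hℓ : ∀ j, h ≤ j → j ≤ g → ℓ j ≤ j * μ₂ ∧ ℓ j ≤ j - lam ∧ ℓ j ≤ lam - j * (1 - μ₁ - μ₂)) :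
    ‖∑ n ∈ Ioc N R₀, ((n : ℂ) + u) ^ (-(t * Complex.I))‖
      ≤ 2 * (N : ℝ) ^ μ₁ * (N : ℝ) ^ μ₂
        + t * ((N : ℝ) ^ μ₁ * (N : ℝ) ^ μ₂) ^ (k + 1) / ((k + 1) * (N : ℝ) ^ k)
        + C₃ ^ (1 / (r : ℝ))
          * (C₁ * C₂ * (5 * (r : ℝ)) ^ k * (16 * (g : ℝ) * 4 ^ g * s) ^ (g - h + 1))
              ^ (1 / (2 * (r : ℝ) * s))
          * (N : ℝ) ^ (1 + (μ₁ * X₁ + μ₂ * E₂ - ∑ j ∈ Finset.Icc h g, ℓ j) / (2 * (r : ℝ) * s)) := by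
  -- notation
  set M₁ : ℝ := (N : ℝ) ^ μ₁ with hM₁
  set M₂ : ℝ := (N : ℝ) ^ μ₂ with hM₂
  set M : ℕ := ⌊M₁⌋₊ with hM
  have hN0 : (0 : ℝ) < N := by positivity
  have hN1 : (1 : ℝ) < N := by exact_mod_cast (by omega : 1 < N)
  have hlogN : 0 < Real.log N := Real.log_pos hN1
  have hM₁1 : 1 ≤ M₁ := Real.one_le_rpow hN1.le hμ₁.le
  have hM₂1 : 1 ≤ M₂ := Real.one_le_rpow hN1.le hμ₂.le
  have hM₂0 : 0 < M₂ := by linarith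
  have hM1 : 1 ≤ M := Nat.le_floor (by simpa using hM₁1)
  have hM0 : (0 : ℝ) < M := by exact_mod_cast hM1
  have hMM₁ : (M : ℝ) ≤ M₁ := Nat.floor_le (by linarith)
  have hM₁M₂ : M₁ * M₂ ≤ N := by
    rw [hM₁, hM₂, ← Real.rpow_add hN0]
    conv_rhs => rw [← Real.rpow_one (N : ℝ)]
    exact Real.rpow_le_rpow_of_exponent_le hN1.le hμ
  have ht0 : 0 < t := by rw [ht]; positivity
  have hr0 : (0 : ℝ) < r := by exact_mod_cast hr
  have hs0 : (0 : ℝ) < s := by exact_mod_cast hs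
  have hk1 : 1 ≤ k := le_trans hh (hhg.trans hgk)
  have hBpos : (0 : ℝ) < B.card := by exact_mod_cast hBne.card_pos
  have hB1 : (1 : ℝ) ≤ B.card := by exact_mod_cast hBne.card_pos
  -- Lemma 5.1
  have h51 := ford_lemma51 (k := k) (h := h) (g := g) B hr hs (by omega) hNR hR hu0 hu1 ht0 hM₁1 hM₂1
    hM₁M₂ hBne hBB
  rw [← hM] at h51
  -- the six factors of `Q`
  set P : ℕ := 2 * r * s with hP
  have hP1 : 2 ≤ P := by rw [hP]; nlinarith
  have hPpos : (0 : ℝ) < (P : ℝ) := by positivity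
  have hPreal : ((P : ℕ) : ℝ) = 2 * (r : ℝ) * s := by rw [hP]; push_cast; ring
  set A1 : ℝ := (B.card : ℝ) ^ (2 * r * s - 2 * s) with hA1
  set A2 : ℝ := (((M : ℝ)) ^ r) ^ (2 * s - 2) with hA2
  set A3 : ℝ := (J k r (Finset.Icc (1 : ℤ) M) : ℝ) with hA3
  set A4 : ℝ := ∏ j : Fin k, (5 : ℝ) * (r * (M : ℝ) ^ (j.val + 1)) with hA4
  set A5 : ℝ := ∏ j : Fin k, (if h ≤ j.val + 1 ∧ j.val + 1 ≤ g then Wj s r N M M₂ t (j.val + 1) else 1)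
    with hA5
  set A6 : ℝ := (Jinc k s (B.map Nat.castEmbedding) h g : ℝ) with hA6
  set Q : ℝ := A1 * A2 * A3 * (A4 * A5 * A6) with hQ
  change ‖∑ n ∈ Ioc N R₀, ((n : ℂ) + u) ^ (-(t * Complex.I))‖
      ≤ 2 * M₁ * M₂ + t * (M₁ * M₂) ^ (k + 1) / ((k + 1) * (N : ℝ) ^ k)
        + N * Q ^ (1 / ((P : ℕ) : ℝ)) / (M * B.card) at h51
  -- positivity of the factors
  have hA1pos : 0 < A1 := by positivity
  have hA2pos : 0 < A2 := by positivity
  have hA3pos : 0 < A3 := by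
    have h1 := card_pow_le_J k r (Finset.Icc (1 : ℤ) M)
    have h2 : 1 ≤ (Finset.Icc (1 : ℤ) M).card ^ r := Nat.one_le_pow _ _ (by simp; omega)
    rw [hA3]; exact_mod_cast (h2.trans h1)
  have hA4pos : 0 < A4 := by rw [hA4]; exact Finset.prod_pos fun j _ => by positivity
  have hWpos : ∀ j, 0 < Wj s r N M M₂ t j := fun j => Wj_pos hs hM₂0 ht0.le
  have hA5pos : 0 < A5 := by
    rw [hA5]; refine Finset.prod_pos fun j _ => ?_
    split_ifs
    · exact hWpos _
    · exact one_pos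
  have hA6pos : 0 < A6 := by
    rw [hA6]
    exact_mod_cast one_le_Jinc k s (Finset.map_nonempty.2 hBne) h g
  have hQpos : 0 < Q := by positivity
  -- logarithms
  set LN : ℝ := Real.log N with hLN
  set lB : ℝ := Real.log B.card with hlB
  set lM : ℝ := Real.log M with hlM
  have hlM0 : 0 ≤ lM := Real.log_nonneg (by exact_mod_cast hM1)
  have hlMle : lM ≤ μ₁ * LN := by
    calc lM ≤ Real.log M₁ := Real.log_le_log hM0 hMM₁
      _ = μ₁ * LN := by rw [hM₁, Real.log_rpow hN0]
  have hlogM₂ : Real.log M₂ = μ₂ * LN := by rw [hM₂, Real.log_rpow hN0]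
  have hlB_ge : μ₂ * LN - Real.log C₃ ≤ lB := by
    have := Real.log_le_log hM₂0 hB
    rw [Real.log_mul hC₃.ne' hBpos.ne', hlogM₂] at this
    linarith
  -- casts of the natural exponents
  have hτ : ((g - h + 1 : ℕ) : ℝ) = (g : ℝ) - h + 1 := by
    rw [Nat.cast_add, Nat.cast_sub hhg]; push_cast; ring
  have hcardIcc : ((Finset.Icc h g).card : ℝ) = (g : ℝ) - h + 1 := by
    rw [Nat.card_Icc, show g + 1 - h = g - h + 1 by omega, hτ]
  have hc1 : ((2 * r * s - 2 * s : ℕ) : ℝ) = 2 * (r : ℝ) * s - 2 * s := by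
    rw [Nat.cast_sub (by nlinarith)]; push_cast; ring
  have hc2 : ((2 * s - 2 : ℕ) : ℝ) = 2 * (s : ℝ) - 2 := by
    rw [Nat.cast_sub (by omega)]; push_cast; ring
  -- (L1)
  have hL1 : Real.log A1 = (2 * (r : ℝ) * s - 2 * s) * lB := by
    rw [hA1, Real.log_pow, hc1]
  -- (L2)
  have hL2 : Real.log A2 = (r : ℝ) * (2 * s - 2) * lM := by
    rw [hA2, Real.log_pow, Real.log_pow, hc2]; ring
  -- (L3)
  have hL3 : Real.log A3 ≤ Real.log C₁ + ((2 * r : ℝ) - ((k * (k + 1) / 2 : ℕ) : ℝ) + X₁) * lM := by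
    have := Real.log_le_log hA3pos hJ
    rwa [Real.log_mul hC₁.ne' (Real.rpow_pos_of_pos hM0 _).ne', Real.log_rpow hM0] at this
  -- (L4)
  have hL4 : Real.log A4 = k * Real.log (5 * r) + ((k * (k + 1) / 2 : ℕ) : ℝ) * lM := by
    have h5r : (0 : ℝ) < 5 * r := by positivity
    rw [hA4, prod_five_r_pow, Real.log_mul (pow_pos h5r k).ne' (pow_pos hM0 _).ne', Real.log_pow,
      Real.log_pow]
  -- (L5)
  obtain ⟨Kw, hKw⟩ : ∃ Kw : ℝ, Kw = 16 * (g : ℝ) * 4 ^ g * s := ⟨_, rfl⟩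
  have hg0 : (0 : ℝ) < g := by exact_mod_cast (show 0 < g by omega)
  have hKw0 : 0 < Kw := by
    rw [hKw]; exact mul_pos (mul_pos (mul_pos (by norm_num) hg0) (by positivity)) hs0
  have hL5 : Real.log A5 ≤ ((g : ℝ) - h + 1) * Real.log Kw
      + ((g : ℝ) - h + 1) * (h + g) / 2 * (μ₂ * LN) - (∑ j ∈ Finset.Icc h g, ℓ j) * LN := by
    have hA5eq : A5 = ∏ m ∈ Finset.Icc h g, Wj s r N M M₂ t m := by
      rw [hA5]; exact prod_fin_indicator_eq hh hgk _
    rw [hA5eq, Real.log_prod (fun m _ => (hWpos m).ne')]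
    have hterm : ∀ m ∈ Finset.Icc h g,
        Real.log (Wj s r N M M₂ t m) ≤ Real.log Kw + (m : ℝ) * (μ₂ * LN) - ℓ m * LN := by
      intro m hm
      rw [Finset.mem_Icc] at hm
      obtain ⟨h1, h2, h3⟩ := hℓ m hm.1 hm.2
      have hW := Wj_le (g := g) hs hr hsr hN (hh.trans hm.1) hm.2 hM₁1 hM hM₂M hM₂ hM₁ ht h1 h2 h3
      rw [← hKw] at hW
      have := Real.log_le_log (hWpos m) hW
      have e : Real.log (Kw * (M₂ ^ m * (N : ℝ) ^ (-ℓ m)))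
          = Real.log Kw + m * Real.log M₂ + (-ℓ m) * LN := by
        rw [Real.log_mul hKw0.ne' (by positivity),
          Real.log_mul (x := M₂ ^ m) (y := (N : ℝ) ^ (-ℓ m)) (by positivity) (by positivity),
          Real.log_pow, Real.log_rpow hN0 (-ℓ m), ← hLN]; ring
      rw [e, hlogM₂] at this
      linarith
    calc ∑ m ∈ Finset.Icc h g, Real.log (Wj s r N M M₂ t m)
        ≤ ∑ m ∈ Finset.Icc h g, (Real.log Kw + (m : ℝ) * (μ₂ * LN) - ℓ m * LN) := Finset.sum_le_sum hterm
      _ = (Finset.Icc h g).card * Real.log Kw + (∑ m ∈ Finset.Icc h g, (m : ℝ)) * (μ₂ * LN)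
          - (∑ j ∈ Finset.Icc h g, ℓ j) * LN := by
          rw [Finset.sum_sub_distrib, Finset.sum_add_distrib, Finset.sum_const, nsmul_eq_mul,
            Finset.sum_mul, Finset.sum_mul]
      _ = _ := by rw [hcardIcc, sum_Icc_cast_eq (by omega)]
  -- (L6)
  have hL6 : Real.log A6 ≤ Real.log C₂
      + ((2 * s : ℝ) - ((g : ℝ) - h + 1) * ((h : ℝ) + g) / 2 + E₂) * (μ₂ * LN) := by
    have := Real.log_le_log hA6pos hJinc
    rwa [Real.log_mul hC₂.ne' (Real.rpow_pos_of_pos hM₂0 _).ne', Real.log_rpow hM₂0, hlogM₂] at this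
  -- the logarithm of `Q`
  obtain ⟨logG, hlogG⟩ : ∃ x : ℝ, x = 2 * s * Real.log C₃ + Real.log C₁ + Real.log C₂
    + k * Real.log (5 * r) + ((g : ℝ) - h + 1) * Real.log Kw := ⟨_, rfl⟩
  obtain ⟨Xtot, hXtot⟩ : ∃ x : ℝ, x = μ₁ * X₁ + μ₂ * E₂ - ∑ j ∈ Finset.Icc h g, ℓ j := ⟨_, rfl⟩
  have hlogQ : Real.log Q ≤ (P : ℝ) * (lM + lB) + logG + Xtot * LN := by
    have hQeq : Real.log Q = Real.log A1 + Real.log A2 + Real.log A3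
        + (Real.log A4 + Real.log A5 + Real.log A6) := by
      rw [hQ, Real.log_mul (by positivity) (by positivity), Real.log_mul (by positivity) (by positivity),
        Real.log_mul (by positivity) (by positivity), Real.log_mul (by positivity) (by positivity),
        Real.log_mul (by positivity) (by positivity)]
    rw [hQeq, hPreal, hlogG, hXtot]
    have hX₁lM : X₁ * lM ≤ X₁ * (μ₁ * LN) := mul_le_mul_of_nonneg_left hlMle hX₁
    have h2s : (0 : ℝ) ≤ 2 * s := by positivity
    have hlB2 : -(2 * (s : ℝ)) * lB ≤ -(2 * (s : ℝ)) * (μ₂ * LN - Real.log C₃) :=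
      mul_le_mul_of_nonpos_left hlB_ge (by linarith)
    linarith [hL1, hL2, hL3, hL4, hL5, hL6, hX₁lM, hlB2]
  -- the third term
  have hT3 : (N : ℝ) * Q ^ (1 / ((P : ℕ) : ℝ)) / (M * B.card)
      ≤ C₃ ^ (1 / (r : ℝ))
          * (C₁ * C₂ * (5 * (r : ℝ)) ^ k * (16 * (g : ℝ) * 4 ^ g * s) ^ (g - h + 1))
              ^ (1 / (2 * (r : ℝ) * s))
          * (N : ℝ) ^ (1 + Xtot / (2 * (r : ℝ) * s)) := by
    rw [← hKw]
    have hlhs_pos : 0 < (N : ℝ) * Q ^ (1 / ((P : ℕ) : ℝ)) / (M * B.card) :=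
      div_pos (mul_pos hN0 (Real.rpow_pos_of_pos hQpos _)) (mul_pos hM0 hBpos)
    have h5r : (0 : ℝ) < 5 * r := by positivity
    have hG0 : 0 < C₁ * C₂ * (5 * (r : ℝ)) ^ k * Kw ^ (g - h + 1) :=
      mul_pos (mul_pos (mul_pos hC₁ hC₂) (pow_pos h5r k)) (pow_pos hKw0 _)
    have hrhs_pos : 0 < C₃ ^ (1 / (r : ℝ)) * (C₁ * C₂ * (5 * (r : ℝ)) ^ k * Kw ^ (g - h + 1))
        ^ (1 / (2 * (r : ℝ) * s)) * (N : ℝ) ^ (1 + Xtot / (2 * (r : ℝ) * s)) :=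
      mul_pos (mul_pos (Real.rpow_pos_of_pos hC₃ _) (Real.rpow_pos_of_pos hG0 _))
        (Real.rpow_pos_of_pos hN0 _)
    rw [← Real.log_le_log_iff hlhs_pos hrhs_pos]
    have hloglhs : Real.log ((N : ℝ) * Q ^ (1 / ((P : ℕ) : ℝ)) / (M * B.card))
        = LN + (1 / (P : ℝ)) * Real.log Q - (lM + lB) := by
      have hQP : 0 < Q ^ (1 / ((P : ℕ) : ℝ)) := Real.rpow_pos_of_pos hQpos _
      rw [Real.log_div (mul_pos hN0 hQP).ne' (mul_pos hM0 hBpos).ne', Real.log_mul hN0.ne' hQP.ne',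
        Real.log_rpow hQpos, Real.log_mul hM0.ne' hBpos.ne']
    have hlogrhs : Real.log (C₃ ^ (1 / (r : ℝ)) * (C₁ * C₂ * (5 * (r : ℝ)) ^ k * Kw ^ (g - h + 1))
        ^ (1 / (2 * (r : ℝ) * s)) * (N : ℝ) ^ (1 + Xtot / (2 * (r : ℝ) * s)))
        = (1 / (r : ℝ)) * Real.log C₃ + (1 / (2 * (r : ℝ) * s)) * (Real.log C₁ + Real.log C₂
          + k * Real.log (5 * r) + ((g : ℝ) - h + 1) * Real.log Kw)
          + (1 + Xtot / (2 * (r : ℝ) * s)) * LN := by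
      have p1 : 0 < C₃ ^ (1 / (r : ℝ)) := Real.rpow_pos_of_pos hC₃ _
      have p2 : 0 < (C₁ * C₂ * (5 * (r : ℝ)) ^ k * Kw ^ (g - h + 1)) ^ (1 / (2 * (r : ℝ) * s)) :=
        Real.rpow_pos_of_pos hG0 _
      have p3 : 0 < (N : ℝ) ^ (1 + Xtot / (2 * (r : ℝ) * s)) := Real.rpow_pos_of_pos hN0 _
      have p4 : 0 < (5 * (r : ℝ)) ^ k := pow_pos h5r k
      have p5 : 0 < Kw ^ (g - h + 1) := pow_pos hKw0 _
      rw [Real.log_mul (mul_pos p1 p2).ne' p3.ne', Real.log_mul p1.ne' p2.ne',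
        Real.log_rpow hC₃, Real.log_rpow hG0, Real.log_rpow hN0,
        Real.log_mul (mul_pos (mul_pos hC₁ hC₂) p4).ne' p5.ne',
        Real.log_mul (mul_pos hC₁ hC₂).ne' p4.ne', Real.log_mul hC₁.ne' hC₂.ne', Real.log_pow,
        Real.log_pow, hτ]
    rw [hloglhs, hlogrhs, hPreal]
    -- divide `hlogQ` by `P`
    have hdiv : (1 / (P : ℝ)) * Real.log Q ≤ (lM + lB) + (1 / (P : ℝ)) * logG + (Xtot / (P : ℝ)) * LN := by
      have := mul_le_mul_of_nonneg_left hlogQ (show (0 : ℝ) ≤ 1 / (P : ℝ) by positivity)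
      have e : (1 / (P : ℝ)) * ((P : ℝ) * (lM + lB) + logG + Xtot * LN)
          = (lM + lB) + (1 / (P : ℝ)) * logG + (Xtot / (P : ℝ)) * LN := by
        field_simp
      linarith
    rw [hPreal] at hdiv
    have e2 : (1 / (2 * (r : ℝ) * s)) * logG = (1 / (r : ℝ)) * Real.log C₃
        + (1 / (2 * (r : ℝ) * s)) * (Real.log C₁ + Real.log C₂ + k * Real.log (5 * r)
          + ((g : ℝ) - h + 1) * Real.log Kw) := by
      rw [hlogG]; field_simp; ring
    have e3 : (1 + Xtot / (2 * (r : ℝ) * s)) * LN = LN + (Xtot / (2 * (r : ℝ) * s)) * LN := by ring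
    rw [e3, ← e2]
    have h1 : LN + 1 / (2 * (r : ℝ) * s) * Real.log Q - (lM + lB)
        ≤ LN + (lM + lB + 1 / (2 * (r : ℝ) * s) * logG + Xtot / (2 * (r : ℝ) * s) * LN) - (lM + lB) :=
      sub_le_sub_right (add_le_add_right hdiv LN) _
    refine h1.trans (le_of_eq ?_)
    ring
  subst hXtot
  exact h51.trans (by gcongr)

/-! ### The minorants `ℓ_j` of (5.11) and their sum (5.12) -/

/-- The regime minorant of `min(jμ₂, j − λ, λ − j(1−μ₁−μ₂))`: `j − λ` for `j ≤ m₂`, `jμ₂` for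
`m₂ < j ≤ m₁`, `λ − j(1−μ₁−μ₂)` for `j > m₁` (`m_i = ⌊λ/(1−μ_i)⌋`). [cite: Ford2002, (5.11)–(5.12)] -/
def ellMin (μ₁ μ₂ lam : ℝ) (m₁ m₂ : ℕ) (j : ℕ) : ℝ :=
  if j ≤ m₂ then (j : ℝ) - lam else if j ≤ m₁ then (j : ℝ) * μ₂ else lam - (j : ℝ) * (1 - μ₁ - μ₂)

/-- **The minorant is below all three quantities** when `m₂(1−μ₂) ≤ λ ≤ (m₂+1)(1−μ₂)`,
`m₁(1−μ₁) ≤ λ ≤ (m₁+1)(1−μ₁)`, `0 ≤ μ₂ ≤ μ₁`, `μ₁ + μ₂ ≤ 1`… (the three regimes of (5.12)).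
[cite: Ford2002, (5.11)–(5.12)] -/
theorem ellMin_le {μ₁ μ₂ lam : ℝ} {m₁ m₂ j : ℕ} (hμ₂ : 0 ≤ μ₂) (hμ : μ₁ + μ₂ ≤ 1)
    (hμ12 : μ₂ ≤ μ₁)
    (h2lo : (m₂ : ℝ) * (1 - μ₂) ≤ lam) (h2hi : lam ≤ ((m₂ : ℝ) + 1) * (1 - μ₂))
    (h1lo : (m₁ : ℝ) * (1 - μ₁) ≤ lam) (h1hi : lam ≤ ((m₁ : ℝ) + 1) * (1 - μ₁)) :
    ellMin μ₁ μ₂ lam m₁ m₂ j ≤ j * μ₂ ∧ ellMin μ₁ μ₂ lam m₁ m₂ j ≤ j - lam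
      ∧ ellMin μ₁ μ₂ lam m₁ m₂ j ≤ lam - j * (1 - μ₁ - μ₂) := by
  unfold ellMin
  have hj0 : (0 : ℝ) ≤ j := Nat.cast_nonneg j
  split_ifs with hA hB
  · -- `j ≤ m₂`: `j(1-μ₂) ≤ λ` and `j(1+c₁₂) ≤ 2λ`
    have hj : (j : ℝ) ≤ m₂ := by exact_mod_cast hA
    refine ⟨by nlinarith, le_refl _, ?_⟩
    nlinarith
  · -- `m₂ < j ≤ m₁`
    have hj1 : (m₂ : ℝ) + 1 ≤ j := by exact_mod_cast (show m₂ + 1 ≤ j by omega)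
    have hj2 : (j : ℝ) ≤ m₁ := by exact_mod_cast hB
    refine ⟨le_refl _, by nlinarith, by nlinarith⟩
  · -- `j > m₁`
    have hj1 : (m₁ : ℝ) + 1 ≤ j := by exact_mod_cast (show m₁ + 1 ≤ j by omega)
    refine ⟨by nlinarith, ?_, le_refl _⟩
    nlinarith

/-- **The sum of the minorants in closed form**: for `h ≤ m₂ + 1`, `m₂ ≤ m₁ ≤ g`,
`∑_{j=h}^{g} ℓ_j = Z₀ + Z₁ λ` with
`Z₀ = S(h,m₂) + μ₂ S(m₂+1,m₁) − (1−μ₁−μ₂) S(m₁+1,g)`, `S(a,b) = (b−a+1)(a+b)/2`, and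
`Z₁ = (g − m₁) − (m₂ + 1 − h)`. [cite: Ford2002, (5.12) and proof of Lemma 5.3 (`H = Z₀ + Z₁λ`)] -/
theorem sum_ellMin_eq {μ₁ μ₂ lam : ℝ} {m₁ m₂ h g : ℕ} (hh : h ≤ m₂ + 1) (h21 : m₂ ≤ m₁)
    (h1g : m₁ ≤ g) :
    ∑ j ∈ Finset.Icc h g, ellMin μ₁ μ₂ lam m₁ m₂ j
      = (((m₂ : ℝ) - h + 1) * (h + m₂) / 2
          + μ₂ * (((m₁ : ℝ) - m₂) * ((m₂ : ℝ) + 1 + m₁) / 2)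
          - (1 - μ₁ - μ₂) * (((g : ℝ) - m₁) * ((m₁ : ℝ) + 1 + g) / 2))
        + (((g : ℝ) - m₁) - ((m₂ : ℝ) + 1 - h)) * lam := by
  -- split `[h, g] = [h, m₂] ∪ [m₂+1, m₁] ∪ [m₁+1, g]`
  have hsplit1 : Finset.Icc h g = Finset.Icc h m₂ ∪ Finset.Icc (m₂ + 1) g := by
    ext j; simp only [Finset.mem_union, Finset.mem_Icc]; omega
  have hdisj1 : Disjoint (Finset.Icc h m₂) (Finset.Icc (m₂ + 1) g) := by
    rw [Finset.disjoint_left]; intro j hj hj'; simp only [Finset.mem_Icc] at hj hj'; omega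
  have hsplit2 : Finset.Icc (m₂ + 1) g = Finset.Icc (m₂ + 1) m₁ ∪ Finset.Icc (m₁ + 1) g := by
    ext j; simp only [Finset.mem_union, Finset.mem_Icc]; omega
  have hdisj2 : Disjoint (Finset.Icc (m₂ + 1) m₁) (Finset.Icc (m₁ + 1) g) := by
    rw [Finset.disjoint_left]; intro j hj hj'; simp only [Finset.mem_Icc] at hj hj'; omega
  rw [hsplit1, Finset.sum_union hdisj1, hsplit2, Finset.sum_union hdisj2]
  have e1 : ∑ j ∈ Finset.Icc h m₂, ellMin μ₁ μ₂ lam m₁ m₂ j = ∑ j ∈ Finset.Icc h m₂, ((j : ℝ) - lam) := by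
    refine Finset.sum_congr rfl fun j hj => ?_
    rw [Finset.mem_Icc] at hj
    simp [ellMin, hj.2]
  have e2 : ∑ j ∈ Finset.Icc (m₂ + 1) m₁, ellMin μ₁ μ₂ lam m₁ m₂ j
      = ∑ j ∈ Finset.Icc (m₂ + 1) m₁, (j : ℝ) * μ₂ := by
    refine Finset.sum_congr rfl fun j hj => ?_
    rw [Finset.mem_Icc] at hj
    have h1 : ¬ (j ≤ m₂) := by omega
    simp [ellMin, h1, hj.2]
  have e3 : ∑ j ∈ Finset.Icc (m₁ + 1) g, ellMin μ₁ μ₂ lam m₁ m₂ j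
      = ∑ j ∈ Finset.Icc (m₁ + 1) g, (lam - (j : ℝ) * (1 - μ₁ - μ₂)) := by
    refine Finset.sum_congr rfl fun j hj => ?_
    rw [Finset.mem_Icc] at hj
    have h1 : ¬ (j ≤ m₂) := by omega
    have h2 : ¬ (j ≤ m₁) := by omega
    simp [ellMin, h1, h2]
  rw [e1, e2, e3, Finset.sum_sub_distrib, Finset.sum_sub_distrib, Finset.sum_const, Finset.sum_const,
    nsmul_eq_mul, nsmul_eq_mul, ← Finset.sum_mul, ← Finset.sum_mul, Nat.card_Icc, Nat.card_Icc,
    sum_Icc_cast_eq hh, sum_Icc_cast_eq (by omega), sum_Icc_cast_eq (by omega)]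
  have c1 : ((m₂ + 1 - h : ℕ) : ℝ) = (m₂ : ℝ) + 1 - h := by
    rw [Nat.cast_sub hh]; push_cast; ring
  have c2 : ((g + 1 - (m₁ + 1) : ℕ) : ℝ) = (g : ℝ) - m₁ := by
    rw [Nat.cast_sub (by omega)]; push_cast; ring
  rw [c1, c2]
  push_cast
  ring

/-! ### Inputs of the wrapper: Theorem 3 row, Lemma 2.2, Theorem 4 conversions -/

/-- **(5.14) from a row of (1.7)**: if `J_{s₃,k}(P) ≤ k^{θk³} P^{2s₃ − k(k+1)/2 + 0.001k²}` for all
`P ≥ 1` and `s₃ ≤ r`, then `J_{r,k}(M) ≤ k^{θk³} M^{2r − k(k+1)/2 + 0.001k²}` (`J_{r,k} ≤ M^{2(r−s₃)} J_{s₃,k}`).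
[cite: Ford2002, (5.13)–(5.14)] -/
theorem J_row_bound {k r s₃ M : ℕ} {θ : ℝ} (hM : 1 ≤ M) (hs₃r : s₃ ≤ r) (hk : 1 ≤ k)
    (hT3 : ∀ P : ℕ, 1 ≤ P → (J k s₃ (Finset.Icc (1 : ℤ) P) : ℝ)
      ≤ (k : ℝ) ^ (θ * (k : ℝ) ^ 3) * (P : ℝ) ^ ((2 * s₃ : ℝ) - ((k * (k + 1) / 2 : ℕ) : ℝ) + 0.001 * (k : ℝ) ^ 2)) :
    (J k r (Finset.Icc (1 : ℤ) M) : ℝ)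
      ≤ (k : ℝ) ^ (θ * (k : ℝ) ^ 3) * (M : ℝ) ^ ((2 * r : ℝ) - ((k * (k + 1) / 2 : ℕ) : ℝ) + 0.001 * (k : ℝ) ^ 2) := by
  have hM0 : (0 : ℝ) < M := by exact_mod_cast hM
  have hk0 : (0 : ℝ) < k := by exact_mod_cast hk
  have hcard : (Finset.Icc (1 : ℤ) M).card = M := by simp
  have h1 := J_add_le k (r - s₃) s₃ (Finset.Icc (1 : ℤ) M)
  rw [Nat.sub_add_cancel hs₃r, hcard] at h1
  have h1' : (J k r (Finset.Icc (1 : ℤ) M) : ℝ) ≤ (M : ℝ) ^ (2 * (r - s₃)) * (J k s₃ (Finset.Icc (1 : ℤ) M) : ℝ) := by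
    exact_mod_cast h1
  have h2 := hT3 M hM
  have hpow : (M : ℝ) ^ (2 * (r - s₃)) * (M : ℝ) ^ ((2 * s₃ : ℝ) - ((k * (k + 1) / 2 : ℕ) : ℝ) + 0.001 * (k : ℝ) ^ 2)
      = (M : ℝ) ^ ((2 * r : ℝ) - ((k * (k + 1) / 2 : ℕ) : ℝ) + 0.001 * (k : ℝ) ^ 2) := by
    rw [← Real.rpow_natCast, ← Real.rpow_add hM0]
    congr 1
    rw [Nat.cast_mul, Nat.cast_sub hs₃r]; push_cast; ring
  calc (J k r (Finset.Icc (1 : ℤ) M) : ℝ) ≤ (M : ℝ) ^ (2 * (r - s₃)) * (J k s₃ (Finset.Icc (1 : ℤ) M) : ℝ) := h1'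
    _ ≤ (M : ℝ) ^ (2 * (r - s₃)) * ((k : ℝ) ^ (θ * (k : ℝ) ^ 3)
          * (M : ℝ) ^ ((2 * s₃ : ℝ) - ((k * (k + 1) / 2 : ℕ) : ℝ) + 0.001 * (k : ℝ) ^ 2)) :=
        mul_le_mul_of_nonneg_left h2 (by positivity)
    _ = _ := by rw [mul_left_comm, hpow]

/-- **`M₂ ≤ C₃ |𝒞(M₂, M₂^η)|`** from `FordVK.card_calC_ge_26` with `R = M₂^η`, `u = 1/η`, and any
integer `w⁺ ≥ 26/(25η)`: `C₃ = (208/7)^{w⁺} (w⁺+1)! · η log M₂`. [cite: Ford2002, (5.19)] -/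
theorem M₂_le_C₃_card {M₂ η : ℝ} {wp : ℕ} (hM₂ : 1 < M₂) (hη : 0 < η)
    (hlogR : 80 ≤ η * Real.log M₂) (hu : 2 ≤ 1 / η) (hwp : 26 * (1 / η) / 25 ≤ wp) :
    M₂ ≤ (208 / 7 : ℝ) ^ wp * ((wp + 1).factorial : ℝ) * (η * Real.log M₂)
      * ((calC M₂ (M₂ ^ η)).card : ℝ) := by
  have hM₂0 : 0 < M₂ := by linarith
  set R : ℝ := M₂ ^ η with hR
  have hR1 : 1 < R := Real.one_lt_rpow hM₂ hη
  have hlogR' : Real.log R = η * Real.log M₂ := by rw [hR, Real.log_rpow hM₂0]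
  have hRu : R ^ (1 / η) = M₂ := by
    rw [hR, ← Real.rpow_mul hM₂0.le, mul_one_div_cancel hη.ne', Real.rpow_one]
  have h := card_calC_ge_26 hR1 (by rw [hlogR']; exact hlogR) (u := 1 / η) hu
  rw [hRu, hlogR'] at h
  -- replace `w = ⌊26u/25⌋` by `w⁺ ≥ 26u/25` (the bound decreases in `w`)
  set w := ⌊26 * (1 / η) / 25⌋₊ with hw
  have hwle : w ≤ wp := by
    rw [hw]; exact Nat.floor_le_of_le (by exact_mod_cast hwp)
  have hL0 : 0 < η * Real.log M₂ := by linarith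
  have hcard0 : 0 ≤ ((calC M₂ (M₂ ^ η)).card : ℝ) := Nat.cast_nonneg _
  -- `(7/208)^wp/(wp+1)! ≤ (7/208)^w/(w+1)!`
  have hmono : (7 / 208 : ℝ) ^ wp / ((wp + 1).factorial : ℝ) ≤ (7 / 208 : ℝ) ^ w / ((w + 1).factorial : ℝ) := by
    have h1 : (7 / 208 : ℝ) ^ wp ≤ (7 / 208 : ℝ) ^ w := pow_le_pow_of_le_one (by norm_num) (by norm_num) hwle
    have h2 : ((w + 1).factorial : ℝ) ≤ ((wp + 1).factorial : ℝ) := by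
      exact_mod_cast Nat.factorial_le (by omega)
    have h3 : (0 : ℝ) < (w + 1).factorial := by exact_mod_cast Nat.factorial_pos _
    exact div_le_div₀ (by positivity) h1 h3 h2
  have hlow : (7 / 208 : ℝ) ^ wp / ((wp + 1).factorial : ℝ) * M₂ / (η * Real.log M₂)
      ≤ ((calC M₂ (M₂ ^ η)).card : ℝ) := by
    refine le_trans ?_ h
    have : 0 ≤ M₂ / (η * Real.log M₂) := by positivity
    calc (7 / 208 : ℝ) ^ wp / ((wp + 1).factorial : ℝ) * M₂ / (η * Real.log M₂)
        = (7 / 208 : ℝ) ^ wp / ((wp + 1).factorial : ℝ) * (M₂ / (η * Real.log M₂)) := by ring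
      _ ≤ (7 / 208 : ℝ) ^ w / ((w + 1).factorial : ℝ) * (M₂ / (η * Real.log M₂)) :=
          mul_le_mul_of_nonneg_right hmono this
      _ = _ := by ring
  have hfac : (0 : ℝ) < (wp + 1).factorial := by exact_mod_cast Nat.factorial_pos _
  have hpow : (0 : ℝ) < (7 / 208 : ℝ) ^ wp := by positivity
  have hlogM : Real.log M₂ ≠ 0 := (Real.log_pos hM₂).ne'
  have key : M₂ = ((208 / 7 : ℝ) ^ wp * ((wp + 1).factorial : ℝ) * (η * Real.log M₂))
      * ((7 / 208 : ℝ) ^ wp / ((wp + 1).factorial : ℝ) * M₂ / (η * Real.log M₂)) := by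
    rw [show (208 / 7 : ℝ) ^ wp = ((7 / 208 : ℝ) ^ wp)⁻¹ by rw [← inv_pow]; norm_num]
    field_simp
  conv_lhs => rw [key]
  exact mul_le_mul_of_nonneg_left hlow (by positivity)

/-- **`J_{s,k,[h,g]}` does not depend on the ambient degree `k ≥ g`.** [folklore] -/
theorem Jinc_eq_of_le {k k' s h g : ℕ} (B : Finset ℤ) (hg : g ≤ k) (hg' : g ≤ k') :
    Jinc k s B h g = Jinc k' s B h g := by
  classical
  rw [Jinc_eq_card, Jinc_eq_card]
  congr 1
  refine Finset.filter_congr fun xy _ => ?_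
  constructor
  · intro H j h1 h2
    have := H ⟨j.val, lt_of_lt_of_le (by omega) hg⟩ h1 h2
    simpa [psv] using this
  · intro H j h1 h2
    have := H ⟨j.val, lt_of_lt_of_le (by omega) hg'⟩ h1 h2
    simpa [psv] using this

/-- **`n! ≤ (n+1)^{n+1} e^{−n}`** (from `(1 + 1/(n+1))^{n+2} ≥ e`). [folklore] -/
theorem factorial_le_pow_div_exp (n : ℕ) :
    (n.factorial : ℝ) ≤ ((n : ℝ) + 1) ^ (n + 1) / Real.exp n := by
  induction n with
  | zero => simp
  | succ n ih =>
    rw [Nat.factorial_succ, Nat.cast_mul, Nat.cast_succ]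
    have hn : (0 : ℝ) < (n : ℝ) + 1 := by positivity
    -- `e ≤ (1 + 1/(n+1))^{n+2}`
    have hkey : Real.exp 1 * ((n : ℝ) + 1) ^ (n + 2) ≤ ((n : ℝ) + 1 + 1) ^ (n + 2) := by
      have hq : (0 : ℝ) < ((n : ℝ) + 1 + 1) / ((n : ℝ) + 1) := by positivity
      have hlog : 1 ≤ ((n : ℝ) + 2) * Real.log (((n : ℝ) + 1 + 1) / ((n : ℝ) + 1)) := by
        have h1 := Real.one_sub_inv_le_log_of_pos hq
        have h2 : 1 - (((n : ℝ) + 1 + 1) / ((n : ℝ) + 1))⁻¹ = 1 / ((n : ℝ) + 2) := by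
          field_simp; ring
        rw [h2] at h1
        have h3 : (0 : ℝ) < (n : ℝ) + 2 := by positivity
        calc (1 : ℝ) = ((n : ℝ) + 2) * (1 / ((n : ℝ) + 2)) := by field_simp
          _ ≤ ((n : ℝ) + 2) * Real.log (((n : ℝ) + 1 + 1) / ((n : ℝ) + 1)) :=
              mul_le_mul_of_nonneg_left h1 h3.le
      have hexp : Real.exp 1 ≤ (((n : ℝ) + 1 + 1) / ((n : ℝ) + 1)) ^ (n + 2) := by
        calc Real.exp 1 ≤ Real.exp (((n : ℝ) + 2) * Real.log (((n : ℝ) + 1 + 1) / ((n : ℝ) + 1))) :=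
              Real.exp_le_exp.2 hlog
          _ = (((n : ℝ) + 1 + 1) / ((n : ℝ) + 1)) ^ (n + 2) := by
              rw [← Real.rpow_natCast, Real.rpow_def_of_pos hq]; push_cast; ring_nf
      rw [div_pow, le_div_iff₀ (by positivity)] at hexp
      linarith
    calc ((n : ℝ) + 1) * (n.factorial : ℝ) ≤ ((n : ℝ) + 1) * (((n : ℝ) + 1) ^ (n + 1) / Real.exp n) :=
          mul_le_mul_of_nonneg_left ih hn.le
      _ = ((n : ℝ) + 1) ^ (n + 2) / Real.exp n := by rw [mul_div_assoc']; ring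
      _ ≤ ((n : ℝ) + 1 + 1) ^ (n + 2) / (Real.exp 1 * Real.exp n) := by
          rw [div_le_div_iff₀ (Real.exp_pos _) (by positivity)]
          nlinarith [hkey, Real.exp_pos (n : ℝ)]
      _ = ((n : ℝ) + 1 + 1) ^ (n + 1 + 1) / Real.exp ((n : ℝ) + 1) := by
          rw [← Real.exp_add]; ring_nf

/-- Logarithmic form: `log n! ≤ (n+1) log(n+1) − n`. [folklore] -/
theorem log_factorial_le (n : ℕ) : Real.log (n.factorial : ℝ) ≤ ((n : ℝ) + 1) * Real.log ((n : ℝ) + 1) - n := by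
  have h := factorial_le_pow_div_exp n
  have h0 : (0 : ℝ) < n.factorial := by exact_mod_cast n.factorial_pos
  have := Real.log_le_log h0 h
  rw [Real.log_div (by positivity) (Real.exp_pos _).ne', Real.log_pow, Real.log_exp] at this
  push_cast at this
  exact this

/-- **`log L ≤ (log L₀/L₀) L` for `e ≤ L₀ ≤ L`** (`log x/x` is decreasing on `[e, ∞)`); with
`L = log N` this is (5.19): `log N ≤ N^{E₃}`, `E₃ = log L₀/L₀`. [cite: Ford2002, (5.19)] -/
theorem log_le_mul_of_ge {L L₀ : ℝ} (hL₀ : Real.exp 1 ≤ L₀) (hL : L₀ ≤ L) :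
    Real.log L ≤ Real.log L₀ / L₀ * L := by
  have hL0 : 0 < L₀ := lt_of_lt_of_le (Real.exp_pos 1) hL₀
  have hLpos : 0 < L := by linarith
  have hanti := Real.log_div_self_antitoneOn hL₀ (hL₀.trans hL) hL
  have : Real.log L / L ≤ Real.log L₀ / L₀ := hanti
  rwa [div_le_iff₀ hLpos] at this

/-! ### One `λ`-interval of Theorem 2 for `λ ≥ 87` from a certified parameter row -/

/-- **Theorem 2 on one `λ`-interval, from Theorem 3 (a row of (1.7)), Theorem 4 and a certified
choice of parameters** (the scheme of the proofs of Lemmas 5.2–5.3: fixed integers `k, h, g, s`,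
`m₁, m₂` on `λ ∈ [λ_lo, λ_hi]`, the sum bounded by `FordVK.sec5_core` with (5.14) from the row of
(1.7) (`FordVK.J_row_bound`), (5.17) from Theorem 4, (5.19) from `FordVK.M₂_le_C₃_card`, and the
conditions on the constant and on the exponent checked at the endpoints). In the nontrivial range
`log N ≥ 300 λ²` the conclusion is `S(N,t) ≤ C N^{1 − 1/(133.66 λ²)}`.
[cite: Ford2002, §5, (5.13)–(5.22) and proofs of Lemmas 5.2, 5.3] -/
theorem sec5_interval
    {k h g s m₁ m₂ wp : ℕ} {lamlo lamhi η ρ θ Ctar : ℝ}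
    -- the row of (1.7) for this `k` (Theorem 3)
    (hT3 : ∃ s₃ : ℕ, 1 ≤ s₃ ∧ (s₃ : ℝ) ≤ ρ * (k : ℝ) ^ 2 ∧ ∀ P : ℕ, 1 ≤ P →
      (J k s₃ (Finset.Icc (1 : ℤ) P) : ℝ) ≤ (k : ℝ) ^ (θ * (k : ℝ) ^ 3)
        * (P : ℝ) ^ ((2 * s₃ : ℝ) - ((k * (k + 1) / 2 : ℕ) : ℝ) + 0.001 * (k : ℝ) ^ 2))
    -- Theorem 4 of the source
    (hT4 : ∀ (k h s : ℕ) (P η D : ℝ), 60 ≤ k → (0.9 : ℝ) * k ≤ h → h + 2 ≤ k →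
      2 * (k - h + 1) ≤ s → s ≤ (h / 2) * (k - h + 1) → 10 ≤ D → Real.exp (D * (k : ℝ) ^ 2) ≤ P →
      2 / (k : ℝ) ^ 3 < η → η ≤ 1 / (2 * (k : ℝ)) →
      18 / (k : ℝ) ≤ 4 * Real.log k / (D * (k : ℝ) ^ 2 * η) →
      4 * Real.log k / (D * (k : ℝ) ^ 2 * η) ≤ 0.4 →
      (Jinc k s ((calC P (P ^ η)).map Nat.castEmbedding) h k : ℝ)
        ≤ Real.exp ((s : ℝ) ^ 2 / ((k : ℝ) - h + 1)
            + 10.5 * ((k : ℝ) - h + 1) * Real.log k ^ 2 / (D * k * η ^ 2)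
            - s * ((1 / η + h) * (1 - 1 / (h : ℝ)) ^ ((s : ℝ) / ((k : ℝ) - h + 1)) - h)
              * Real.log (1 / (10 * η)))
          * P ^ ((2 * s : ℝ) - ((k : ℝ) - h + 1) / 2 * (h + k) + ((k : ℝ) - h + 1) * ((k : ℝ) - h) / 2
            + η * (s : ℝ) ^ 2 / (2 * ((k : ℝ) - h + 1))
            + h * ((k : ℝ) - h + 1) * Real.exp (-(s : ℝ) / (h * ((k : ℝ) - h + 1)))))
    -- the certificate conditions (rational data; verified by the interval checker)
    (c0 : 87 ≤ lamlo) (c0' : lamlo ≤ lamhi) (hη : 0 < η) (hCtar : 0.002 < Ctar)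
    (c1 : lamhi - 0.6492 * k + 0.3508 ≤ 1 - 1.9e-6)
    (c2a : 60 ≤ g) (c2b : (0.9 : ℝ) * g ≤ h) (c2c : h + 2 ≤ g) (c2d : 2 * (g - h + 1) ≤ s)
    (c2e : s ≤ (h / 2) * (g - h + 1))
    (c3 : 30.57 * (g : ℝ) ^ 2 ≤ 0.1603 * 300 * lamlo ^ 2)
    (c4a : 2 / (g : ℝ) ^ 3 < η) (c4b : η ≤ 1 / (2 * (g : ℝ)))
    (c4c : 18 / (g : ℝ) ≤ 4 * Real.log g / (30.57 * (g : ℝ) ^ 2 * η))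
    (c4d : 4 * Real.log g / (30.57 * (g : ℝ) ^ 2 * η) ≤ 0.4)
    (c5a : 80 ≤ η * (0.1603 * 300 * lamlo ^ 2)) (c5b : 2 ≤ 1 / η) (c5c : 26 * (1 / η) / 25 ≤ wp)
    (c6a : h ≤ m₂ + 1) (c6b : m₂ ≤ m₁) (c6c : m₁ ≤ g)
    (c6d : (m₂ : ℝ) * (1 - 0.1603) ≤ lamlo) (c6e : lamhi ≤ ((m₂ : ℝ) + 1) * (1 - 0.1603))
    (c6f : (m₁ : ℝ) * (1 - 0.1905) ≤ lamlo) (c6g : lamhi ≤ ((m₁ : ℝ) + 1) * (1 - 0.1905))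
    (c7a : s ≤ ⌊ρ * (k : ℝ) ^ 2⌋₊ + 1) (c7b : 1 ≤ h) (c7c : g ≤ k)
    (c8 : (1 / ((⌊ρ * (k : ℝ) ^ 2⌋₊ : ℕ) + 1 : ℝ))
        * (wp * Real.log (208 / 7) + ((wp : ℝ) + 2) * Real.log ((wp : ℝ) + 2) - ((wp : ℝ) + 1)
          + Real.log (η * 0.1603))
        + (1 / (2 * (((⌊ρ * (k : ℝ) ^ 2⌋₊ : ℕ) : ℝ) + 1) * s))
          * (θ * (k : ℝ) ^ 3 * Real.log k
            + ((s : ℝ) ^ 2 / ((g : ℝ) - h + 1)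
              + 10.5 * ((g : ℝ) - h + 1) * Real.log g ^ 2 / (30.57 * g * η ^ 2)
              - s * ((1 / η + h) * (1 - 1 / (h : ℝ)) ^ ((s : ℝ) / ((g : ℝ) - h + 1)) - h)
                * Real.log (1 / (10 * η)))
            + k * Real.log (5 * ((((⌊ρ * (k : ℝ) ^ 2⌋₊ : ℕ) : ℝ) + 1)))
            + ((g : ℝ) - h + 1) * Real.log (16 * (g : ℝ) * 4 ^ g * s))
        ≤ Real.log (Ctar - 0.002))
    (c9 : ∀ lstar : ℝ, lstar = lamlo ∨ lstar = lamhi →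
      Real.log (300 * lamlo ^ 2) / (300 * lamlo ^ 2) / ((((⌊ρ * (k : ℝ) ^ 2⌋₊ : ℕ) : ℝ) + 1))
        + (0.1905 * (0.001 * (k : ℝ) ^ 2)
            + 0.1603 * (((g : ℝ) - h + 1) * ((g : ℝ) - h) / 2 + η * (s : ℝ) ^ 2 / (2 * ((g : ℝ) - h + 1))
              + h * ((g : ℝ) - h + 1) * Real.exp (-(s : ℝ) / (h * ((g : ℝ) - h + 1))))
            - ((((m₂ : ℝ) - h + 1) * (h + m₂) / 2
                + 0.1603 * (((m₁ : ℝ) - m₂) * ((m₂ : ℝ) + 1 + m₁) / 2)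
                - (1 - 0.1905 - 0.1603) * (((g : ℝ) - m₁) * ((m₁ : ℝ) + 1 + g) / 2))
              + (((g : ℝ) - m₁) - ((m₂ : ℝ) + 1 - h)) * lstar))
          / (2 * ((((⌊ρ * (k : ℝ) ^ 2⌋₊ : ℕ) : ℝ) + 1)) * s)
        + 1 / (133.66 * lamlo ^ 2) ≤ 0)
    -- the sum
    {N R₀ : ℕ} {t u : ℝ} (hN : 2 ≤ N) (hNR : N < R₀) (hR : R₀ ≤ 2 * N) (hu0 : 0 < u) (hu1 : u ≤ 1)
    (ht0 : 0 < t) (hlo : lamlo * Real.log N ≤ Real.log t) (hhi : Real.log t ≤ lamhi * Real.log N)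
    (hbig : 300 * (Real.log t / Real.log N) ^ 2 ≤ Real.log N) :
    ‖∑ n ∈ Ioc N R₀, ((n : ℂ) + u) ^ (-(t * Complex.I))‖
      ≤ Ctar * (N : ℝ) ^ (1 - Real.log N ^ 2 / (133.66 * Real.log t ^ 2)) := by
  -- ### basic quantities
  have hN0 : (0 : ℝ) < N := by positivity
  have hN1 : (1 : ℝ) < N := by exact_mod_cast (by omega : 1 < N)
  set L : ℝ := Real.log N with hL
  have hLpos : 0 < L := Real.log_pos hN1
  obtain ⟨lam, hlam⟩ : ∃ x : ℝ, x = Real.log t / L := ⟨_, rfl⟩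
  have hlamlo : lamlo ≤ lam := by rw [hlam, le_div_iff₀ hLpos]; exact hlo
  have hlamhi : lam ≤ lamhi := by rw [hlam, div_le_iff₀ hLpos]; exact hhi
  have hlam87 : 87 ≤ lam := c0.trans hlamlo
  have hlam0 : 0 < lam := by linarith only [hlam87]
  have hlogt : Real.log t = lam * L := by rw [hlam]; field_simp
  have ht : t = (N : ℝ) ^ lam := by
    rw [Real.rpow_def_of_pos hN0, ← hL, mul_comm, ← hlogt, Real.exp_log ht0]
  have hLlam : 300 * lam ^ 2 ≤ L := by rw [hlam]; exact hbig
  have hLlo : 300 * lamlo ^ 2 ≤ L := le_trans (by nlinarith only [hlamlo, c0]) hLlam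
  have hLge : (2270700 : ℝ) ≤ L := le_trans (by nlinarith only [c0]) hLlo
  -- `r`
  set r : ℕ := ⌊ρ * (k : ℝ) ^ 2⌋₊ + 1 with hr
  have hr1 : 1 ≤ r := by omega
  have hrreal : (r : ℝ) = ((⌊ρ * (k : ℝ) ^ 2⌋₊ : ℕ) : ℝ) + 1 := by rw [hr]; push_cast; ring
  have hr0 : (0 : ℝ) < r := by positivity
  -- `k ≥ 133`
  have hk133 : (133 : ℝ) ≤ k := by linarith only [c1, c0, c0']
  have hk1 : 1 ≤ k := by
    have : (1 : ℝ) ≤ k := by linarith only [hk133]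
    exact_mod_cast this
  have hkpos : (0 : ℝ) < k := by linarith only [hk133]
  -- ### `M₁`, `M₂`, `M`
  set M₁ : ℝ := (N : ℝ) ^ (0.1905 : ℝ) with hM₁
  set M₂ : ℝ := (N : ℝ) ^ (0.1603 : ℝ) with hM₂
  set M : ℕ := ⌊M₁⌋₊ with hM
  have hlogM₂ : Real.log M₂ = 0.1603 * L := by rw [hM₂, Real.log_rpow hN0]
  have hlogM₁ : Real.log M₁ = 0.1905 * L := by rw [hM₁, Real.log_rpow hN0]
  have hM₂1 : 1 < M₂ := Real.one_lt_rpow hN1 (by norm_num)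
  have hM₂0 : 0 < M₂ := by linarith only [hM₂1]
  have hM₁1 : 1 ≤ M₁ := Real.one_le_rpow hN1.le (by norm_num)
  have hM1 : 1 ≤ M := Nat.le_floor (by simpa using hM₁1)
  have hM₂M : M₂ ≤ M := by
    -- `M₁ = M₂ N^{0.0302} ≥ 2 M₂`, `M ≥ M₁ - 1`
    have h1 : M₁ = M₂ * (N : ℝ) ^ (0.0302 : ℝ) := by
      rw [hM₁, hM₂, ← Real.rpow_add hN0]; norm_num
    have h2 : (2 : ℝ) ≤ (N : ℝ) ^ (0.0302 : ℝ) := by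
      have : Real.log 2 ≤ 0.0302 * L := by
        have := Real.log_two_lt_d9; linarith only [this, hLge]
      calc (2 : ℝ) = Real.exp (Real.log 2) := (Real.exp_log two_pos).symm
        _ ≤ Real.exp (0.0302 * L) := Real.exp_le_exp.2 this
        _ = (N : ℝ) ^ (0.0302 : ℝ) := by rw [Real.rpow_def_of_pos hN0, hL]; ring_nf
    have h3 : (M : ℝ) ≥ M₁ - 1 := by
      have := Nat.lt_floor_add_one M₁; rw [← hM] at this; linarith only [this]
    have h4 : 2 * M₂ ≤ M₁ := by rw [h1]; nlinarith only [h2, hM₂0]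
    linarith only [h3, h4, hM₂1]
  -- ### (5.19): `M₂ ≤ C₃ |ℬ|`
  set B : Finset ℕ := calC M₂ (M₂ ^ η) with hB
  have hlogR : 80 ≤ η * Real.log M₂ := by
    rw [hlogM₂]
    calc (80 : ℝ) ≤ η * (0.1603 * 300 * lamlo ^ 2) := c5a
      _ ≤ η * (0.1603 * L) := by nlinarith only [hLlo, hη]
  have hBbound := M₂_le_C₃_card hM₂1 hη hlogR c5b c5c
  rw [← hB] at hBbound
  obtain ⟨C₃, hC₃def⟩ : ∃ x : ℝ, x = (208 / 7 : ℝ) ^ wp * ((wp + 1).factorial : ℝ) * (η * Real.log M₂) :=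
    ⟨_, rfl⟩
  rw [← hC₃def] at hBbound
  have hC₃pos : 0 < C₃ := by
    rw [hC₃def]
    have : (0 : ℝ) < (wp + 1).factorial := by exact_mod_cast Nat.factorial_pos _
    have : 0 < η * Real.log M₂ := by linarith only [hlogR]
    positivity
  -- ### (5.14): the row of (1.7)
  obtain ⟨s₃, hs₃1, hs₃ρ, hT3P⟩ := hT3
  have hs₃r : s₃ ≤ r := by
    have : s₃ ≤ ⌊ρ * (k : ℝ) ^ 2⌋₊ := Nat.le_floor hs₃ρ
    omega
  have hJ := J_row_bound (M := M) (θ := θ) hM1 hs₃r hk1 hT3P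
  -- ### (5.17): Theorem 4 at `(g, h, s, M₂, η, D = 30.57)`
  have hexpM₂ : Real.exp (30.57 * (g : ℝ) ^ 2) ≤ M₂ := by
    have : 30.57 * (g : ℝ) ^ 2 ≤ Real.log M₂ := by
      rw [hlogM₂]
      calc 30.57 * (g : ℝ) ^ 2 ≤ 0.1603 * 300 * lamlo ^ 2 := c3
        _ ≤ 0.1603 * L := by nlinarith only [hLlo]
    calc Real.exp (30.57 * (g : ℝ) ^ 2) ≤ Real.exp (Real.log M₂) := Real.exp_le_exp.2 this
      _ = M₂ := Real.exp_log hM₂0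
  have h4 := hT4 g h s M₂ η 30.57 c2a c2b c2c c2d c2e (by norm_num) hexpM₂ c4a c4b c4c c4d
  rw [← hB, Jinc_eq_of_le (B.map Nat.castEmbedding) (le_refl g) c7c] at h4
  obtain ⟨E₂, hE₂⟩ : ∃ x : ℝ, x = ((g : ℝ) - h + 1) * ((g : ℝ) - h) / 2
      + η * (s : ℝ) ^ 2 / (2 * ((g : ℝ) - h + 1))
      + h * ((g : ℝ) - h + 1) * Real.exp (-(s : ℝ) / (h * ((g : ℝ) - h + 1))) := ⟨_, rfl⟩
  obtain ⟨CT4, hCT4⟩ : ∃ x : ℝ, x = (s : ℝ) ^ 2 / ((g : ℝ) - h + 1)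
      + 10.5 * ((g : ℝ) - h + 1) * Real.log g ^ 2 / (30.57 * g * η ^ 2)
      - s * ((1 / η + h) * (1 - 1 / (h : ℝ)) ^ ((s : ℝ) / ((g : ℝ) - h + 1)) - h)
        * Real.log (1 / (10 * η)) := ⟨_, rfl⟩
  have hJinc : (Jinc k s (B.map Nat.castEmbedding) h g : ℝ)
      ≤ Real.exp CT4 * M₂ ^ ((2 * s : ℝ) - ((g : ℝ) - h + 1) * ((h : ℝ) + g) / 2 + E₂) := by
    have e : (2 * s : ℝ) - ((g : ℝ) - h + 1) / 2 * (h + g) + ((g : ℝ) - h + 1) * ((g : ℝ) - h) / 2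
        + η * (s : ℝ) ^ 2 / (2 * ((g : ℝ) - h + 1))
        + h * ((g : ℝ) - h + 1) * Real.exp (-(s : ℝ) / (h * ((g : ℝ) - h + 1)))
        = (2 * s : ℝ) - ((g : ℝ) - h + 1) * ((h : ℝ) + g) / 2 + E₂ := by rw [hE₂]; ring
    rw [hCT4, ← e]; exact h4
  -- ### (5.11): the minorants
  have hμ : (0.1905 : ℝ) + 0.1603 ≤ 1 := by norm_num
  have hℓ : ∀ j, h ≤ j → j ≤ g →
      ellMin 0.1905 0.1603 lam m₁ m₂ j ≤ j * 0.1603 ∧ ellMin 0.1905 0.1603 lam m₁ m₂ j ≤ j - lam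
        ∧ ellMin 0.1905 0.1603 lam m₁ m₂ j ≤ lam - j * (1 - 0.1905 - 0.1603) := by
    intro j _ _
    exact ellMin_le (by norm_num) hμ (by norm_num) (by linarith only [c6d, hlamlo])
      (by linarith only [c6e, hlamhi]) (by linarith only [c6f, hlamlo]) (by linarith only [c6g, hlamhi])
  -- ### the core deduction
  have hs1 : 1 ≤ s := by omega
  have hhg : h ≤ g := by omega
  have hcore := sec5_core (ellMin 0.1905 0.1603 lam m₁ m₂) B hN hNR hR hu0 hu1 ht
    (by norm_num : (0 : ℝ) < 0.1905) (by norm_num : (0 : ℝ) < 0.1603) hμ hr1 hs1 c7a c7b hhg c7c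
    hM₂M (calC_nonempty hM₂1.le _) (calC_bounds hM₂0.le) (Real.rpow_pos_of_pos hkpos _)
    (Real.exp_pos CT4) hC₃pos (by positivity : (0 : ℝ) ≤ 0.001 * (k : ℝ) ^ 2) hBbound hJ hJinc hℓ
  rw [sum_ellMin_eq c6a c6b c6c] at hcore
  -- ### names for the pieces of the third term
  obtain ⟨Z₀, hZ₀⟩ : ∃ x : ℝ, x = ((m₂ : ℝ) - h + 1) * (h + m₂) / 2
      + 0.1603 * (((m₁ : ℝ) - m₂) * ((m₂ : ℝ) + 1 + m₁) / 2)
      - (1 - 0.1905 - 0.1603) * (((g : ℝ) - m₁) * ((m₁ : ℝ) + 1 + g) / 2) := ⟨_, rfl⟩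
  obtain ⟨Z₁, hZ₁⟩ : ∃ x : ℝ, x = ((g : ℝ) - m₁) - ((m₂ : ℝ) + 1 - h) := ⟨_, rfl⟩
  obtain ⟨Q, hQ⟩ : ∃ x : ℝ, x = 0.1905 * (0.001 * (k : ℝ) ^ 2) + 0.1603 * E₂ := ⟨_, rfl⟩
  obtain ⟨G, hG⟩ : ∃ x : ℝ, x = (k : ℝ) ^ (θ * (k : ℝ) ^ 3) * Real.exp CT4 * (5 * (r : ℝ)) ^ k
      * (16 * (g : ℝ) * 4 ^ g * s) ^ (g - h + 1) := ⟨_, rfl⟩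
  rw [← hZ₀, ← hZ₁, ← hG] at hcore
  have hXQ : 0.1905 * (0.001 * (k : ℝ) ^ 2) + 0.1603 * E₂ - (Z₀ + Z₁ * lam) = Q - (Z₀ + Z₁ * lam) := by
    rw [hQ]
  rw [hXQ] at hcore
  -- positivity
  have hg0 : (0 : ℝ) < g := by exact_mod_cast (show 0 < g by omega)
  have hs0 : (0 : ℝ) < s := by exact_mod_cast hs1
  have hKw0 : (0 : ℝ) < 16 * (g : ℝ) * 4 ^ g * s := by positivity
  have h5r : (0 : ℝ) < 5 * r := by positivity
  have hGpos : 0 < G := by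
    rw [hG]
    exact mul_pos (mul_pos (mul_pos (Real.rpow_pos_of_pos hkpos _) (Real.exp_pos _)) (pow_pos h5r k))
      (pow_pos hKw0 _)
  have hτ : ((g - h + 1 : ℕ) : ℝ) = (g : ℝ) - h + 1 := by
    rw [Nat.cast_add, Nat.cast_sub hhg]; push_cast; ring
  -- ### logarithms of the constants
  have hlogG : Real.log G = θ * (k : ℝ) ^ 3 * Real.log k + CT4 + k * Real.log (5 * r)
      + ((g : ℝ) - h + 1) * Real.log (16 * (g : ℝ) * 4 ^ g * s) := by
    rw [hG, Real.log_mul (mul_pos (mul_pos (Real.rpow_pos_of_pos hkpos _) (Real.exp_pos _)) (pow_pos h5r k)).ne'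
        (pow_pos hKw0 _).ne',
      Real.log_mul (mul_pos (Real.rpow_pos_of_pos hkpos _) (Real.exp_pos _)).ne' (pow_pos h5r k).ne',
      Real.log_mul (Real.rpow_pos_of_pos hkpos _).ne' (Real.exp_pos _).ne',
      Real.log_rpow hkpos, Real.log_exp, Real.log_pow, Real.log_pow, hτ]
  have hfac0 : (0 : ℝ) < (wp + 1).factorial := by exact_mod_cast Nat.factorial_pos _
  have hηL : 0 < η * 0.1603 := by positivity
  have hlogC₃ : Real.log C₃ = wp * Real.log (208 / 7) + Real.log ((wp + 1).factorial : ℝ)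
      + Real.log (η * 0.1603) + Real.log L := by
    rw [hC₃def, hlogM₂, show η * (0.1603 * L) = (η * 0.1603) * L by ring,
      Real.log_mul (mul_pos (pow_pos (by norm_num) wp) hfac0).ne' (mul_pos hηL hLpos).ne',
      Real.log_mul (pow_pos (by norm_num) wp).ne' hfac0.ne', Real.log_pow,
      Real.log_mul hηL.ne' hLpos.ne']
    ring
  have hlogfac : Real.log ((wp + 1).factorial : ℝ) ≤ ((wp : ℝ) + 2) * Real.log ((wp : ℝ) + 2) - ((wp : ℝ) + 1) := by
    have := log_factorial_le (wp + 1)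
    push_cast at this
    convert this using 2; ring
  -- `log L ≤ E₃ L`
  have hE₃ : Real.log L ≤ Real.log (300 * lamlo ^ 2) / (300 * lamlo ^ 2) * L := by
    refine log_le_mul_of_ge ?_ hLlo
    have := Real.exp_one_lt_d9
    nlinarith only [this, c0]
  -- ### the exponent: `c9` at `lam` by affine interpolation
  obtain ⟨d', hd'⟩ : ∃ x : ℝ, x = 1 / (133.66 * lamlo ^ 2) := ⟨_, rfl⟩
  have hrs0 : (0 : ℝ) < 2 * (r : ℝ) * s := by positivity
  have hexp_le : Real.log (300 * lamlo ^ 2) / (300 * lamlo ^ 2) / r + (Q - (Z₀ + Z₁ * lam)) / (2 * (r : ℝ) * s)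
      + d' ≤ 0 := by
    have c9lo := c9 lamlo (Or.inl rfl)
    have c9hi := c9 lamhi (Or.inr rfl)
    rw [← hrreal, ← hE₂, ← hZ₀, ← hZ₁, ← hQ, ← hd'] at c9lo c9hi
    rcases le_or_gt 0 Z₁ with hz | hz
    · have : (Q - (Z₀ + Z₁ * lam)) / (2 * (r : ℝ) * s) ≤ (Q - (Z₀ + Z₁ * lamlo)) / (2 * (r : ℝ) * s) :=
        div_le_div_of_nonneg_right (by nlinarith only [hz, hlamlo]) hrs0.le
      linarith only [this, c9lo]
    · have : (Q - (Z₀ + Z₁ * lam)) / (2 * (r : ℝ) * s) ≤ (Q - (Z₀ + Z₁ * lamhi)) / (2 * (r : ℝ) * s) :=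
        div_le_div_of_nonneg_right (by nlinarith only [hz, hlamhi]) hrs0.le
      linarith only [this, c9hi]
  -- ### the third term `≤ (Ctar - 0.002) N^{1 - d'}`
  have hCt : 0 < Ctar - 0.002 := by linarith only [hCtar]
  have hthird : C₃ ^ (1 / (r : ℝ)) * G ^ (1 / (2 * (r : ℝ) * s))
      * (N : ℝ) ^ (1 + (Q - (Z₀ + Z₁ * lam)) / (2 * (r : ℝ) * s))
      ≤ (Ctar - 0.002) * (N : ℝ) ^ (1 - d') := by
    have hlhs : 0 < C₃ ^ (1 / (r : ℝ)) * G ^ (1 / (2 * (r : ℝ) * s))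
        * (N : ℝ) ^ (1 + (Q - (Z₀ + Z₁ * lam)) / (2 * (r : ℝ) * s)) :=
      mul_pos (mul_pos (Real.rpow_pos_of_pos hC₃pos _) (Real.rpow_pos_of_pos hGpos _))
        (Real.rpow_pos_of_pos hN0 _)
    have hrhs : 0 < (Ctar - 0.002) * (N : ℝ) ^ (1 - d') := mul_pos hCt (Real.rpow_pos_of_pos hN0 _)
    rw [← Real.log_le_log_iff hlhs hrhs,
      Real.log_mul (mul_pos (Real.rpow_pos_of_pos hC₃pos _) (Real.rpow_pos_of_pos hGpos _)).ne'
        (Real.rpow_pos_of_pos hN0 _).ne',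
      Real.log_mul (Real.rpow_pos_of_pos hC₃pos _).ne' (Real.rpow_pos_of_pos hGpos _).ne',
      Real.log_rpow hC₃pos, Real.log_rpow hGpos, Real.log_rpow hN0, Real.log_mul hCt.ne' (Real.rpow_pos_of_pos hN0 _).ne',
      Real.log_rpow hN0, ← hL, hlogC₃, hlogG]
    rw [← hrreal, ← hCT4] at c8
    -- the coefficient `1/r · log L ≤ E₃/r · L`
    have h1 : 1 / (r : ℝ) * Real.log L ≤ 1 / (r : ℝ) * (Real.log (300 * lamlo ^ 2) / (300 * lamlo ^ 2) * L) :=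
      mul_le_mul_of_nonneg_left hE₃ (by positivity)
    have h2 : 1 / (r : ℝ) * Real.log ((wp + 1).factorial : ℝ)
        ≤ 1 / (r : ℝ) * (((wp : ℝ) + 2) * Real.log ((wp : ℝ) + 2) - ((wp : ℝ) + 1)) :=
      mul_le_mul_of_nonneg_left hlogfac (by positivity)
    have h3 : (Real.log (300 * lamlo ^ 2) / (300 * lamlo ^ 2) / r + (Q - (Z₀ + Z₁ * lam)) / (2 * (r : ℝ) * s)
        + d') * L ≤ 0 := mul_nonpos_of_nonpos_of_nonneg hexp_le hLpos.le
    have e1 : Real.log (300 * lamlo ^ 2) / (300 * lamlo ^ 2) / r * L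
        = 1 / (r : ℝ) * (Real.log (300 * lamlo ^ 2) / (300 * lamlo ^ 2) * L) := by ring
    have e2 : (1 + (Q - (Z₀ + Z₁ * lam)) / (2 * (r : ℝ) * s)) * L
        = L + (Q - (Z₀ + Z₁ * lam)) / (2 * (r : ℝ) * s) * L := by ring
    have e3 : (1 - d') * L = L - d' * L := by ring
    nlinarith only [c8, h1, h2, h3, e1, e2, e3]
  -- ### the saving `d = 1/(133.66 λ²)` and `d ≤ d' ≤ 10⁻⁶`
  obtain ⟨d, hd⟩ : ∃ x : ℝ, x = 1 / (133.66 * lam ^ 2) := ⟨_, rfl⟩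
  have hgoal : 1 - L ^ 2 / (133.66 * Real.log t ^ 2) = 1 - d := by
    rw [hd, hlogt]; field_simp
  rw [hgoal]
  have hdd' : d ≤ d' := by
    rw [hd, hd']
    exact one_div_le_one_div_of_le (by positivity) (by nlinarith only [hlamlo, c0])
  have hd'small : d' ≤ 1e-6 := by
    rw [hd', div_le_iff₀ (by positivity)]; nlinarith only [c0]
  have hd0 : 0 ≤ d := by rw [hd]; positivity
  set X : ℝ := (N : ℝ) ^ (1 - d) with hX
  have hXpos : 0 < X := Real.rpow_pos_of_pos hN0 _
  have hpow_le : (N : ℝ) ^ (1 - d') ≤ X := Real.rpow_le_rpow_of_exponent_le hN1.le (by linarith only [hdd'])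
  -- ### `T1 ≤ 0.0005 X`
  have hT1 : 2 * (N : ℝ) ^ (0.1905 : ℝ) * (N : ℝ) ^ (0.1603 : ℝ) ≤ 0.0005 * X := by
    have e1 : 2 * (N : ℝ) ^ (0.1905 : ℝ) * (N : ℝ) ^ (0.1603 : ℝ) = 2 * (N : ℝ) ^ (0.3508 : ℝ) := by
      rw [mul_assoc, ← Real.rpow_add hN0]; norm_num
    have e2 : X = (N : ℝ) ^ (0.3508 : ℝ) * (N : ℝ) ^ (0.6492 - d) := by
      rw [hX, ← Real.rpow_add hN0]; ring_nf
    have h1 : (4000 : ℝ) ≤ (N : ℝ) ^ (0.6492 - d) := by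
      have : (4000 : ℝ) ≤ (N : ℝ) ^ (0.6 : ℝ) := by
        rw [Real.rpow_def_of_pos hN0, ← hL]
        have := Real.add_one_le_exp (L * 0.6)
        nlinarith only [this, hLge]
      exact this.trans (Real.rpow_le_rpow_of_exponent_le hN1.le (by linarith only [hdd', hd'small]))
    rw [e1, e2]
    have : (0 : ℝ) ≤ (N : ℝ) ^ (0.3508 : ℝ) := by positivity
    nlinarith only [h1, this]
  -- ### `T2 ≤ 0.0015 X`
  have hT2 : t * ((N : ℝ) ^ (0.1905 : ℝ) * (N : ℝ) ^ (0.1603 : ℝ)) ^ (k + 1) / ((k + 1) * (N : ℝ) ^ k)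
      ≤ 0.0015 * X := by
    have e1 : t * ((N : ℝ) ^ (0.1905 : ℝ) * (N : ℝ) ^ (0.1603 : ℝ)) ^ (k + 1) / ((k + 1) * (N : ℝ) ^ k)
        = (N : ℝ) ^ (lam + 0.3508 * ((k : ℝ) + 1) - k) / ((k : ℝ) + 1) := by
      rw [ht, ← Real.rpow_add hN0, ← Real.rpow_natCast, ← Real.rpow_mul hN0.le, ← Real.rpow_add hN0,
        ← Real.rpow_natCast (N : ℝ) k, Real.rpow_sub hN0]
      push_cast
      field_simp
      ring_nf
    have hexp2 : lam + 0.3508 * ((k : ℝ) + 1) - k ≤ (1 - d) + (-9e-7) := by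
      linarith only [c1, hlamhi, hdd', hd'small]
    have h2 : (N : ℝ) ^ (lam + 0.3508 * ((k : ℝ) + 1) - k) ≤ X * (N : ℝ) ^ (-9e-7 : ℝ) := by
      rw [hX, ← Real.rpow_add hN0]
      exact Real.rpow_le_rpow_of_exponent_le hN1.le hexp2
    have h3 : (N : ℝ) ^ (-9e-7 : ℝ) ≤ 0.2 := by
      rw [Real.rpow_neg hN0.le, ← one_div, div_le_iff₀ (Real.rpow_pos_of_pos hN0 _), ← div_le_iff₀' (by norm_num)]
      rw [Real.rpow_def_of_pos hN0, ← hL]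
      have := Real.quadratic_le_exp_of_nonneg (show (0 : ℝ) ≤ L * 9e-7 by positivity)
      nlinarith only [this, hLge]
    have hk1' : (134 : ℝ) ≤ (k : ℝ) + 1 := by linarith only [hk133]
    rw [e1, div_le_iff₀ (by positivity)]
    calc (N : ℝ) ^ (lam + 0.3508 * ((k : ℝ) + 1) - k) ≤ X * (N : ℝ) ^ (-9e-7 : ℝ) := h2
      _ ≤ X * 0.2 := mul_le_mul_of_nonneg_left h3 hXpos.le
      _ ≤ 0.0015 * X * ((k : ℝ) + 1) := by nlinarith only [hk1', hXpos]
  -- ### total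
  have hthird' : C₃ ^ (1 / (r : ℝ)) * G ^ (1 / (2 * (r : ℝ) * s))
      * (N : ℝ) ^ (1 + (Q - (Z₀ + Z₁ * lam)) / (2 * (r : ℝ) * s)) ≤ (Ctar - 0.002) * X :=
    hthird.trans (mul_le_mul_of_nonneg_left hpow_le hCt.le)
  linarith only [hcore, hT1, hT2, hthird']

/-! ### The trivial range `log N ≤ 300 λ²` -/

/-- `e^{300/133.66} ≤ 9.44`. [folklore] -/
theorem exp_300_div_le : Real.exp (300 / 133.66) ≤ 9.44 := by
  have h1 : Real.exp (300 / 133.66) ≤ Real.exp (2 + 0.2446) := Real.exp_le_exp.2 (by norm_num)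
  rw [Real.exp_add] at h1
  have h2 : Real.exp 2 ≤ 2.7182818286 ^ 2 := by
    rw [show (2 : ℝ) = ((2 : ℕ) : ℝ) by norm_num, ← Real.exp_one_pow 2]
    exact pow_le_pow_left₀ (Real.exp_pos 1).le Real.exp_one_lt_d9.le 2
  have h3 : Real.exp 0.2446 ≤ 1.2772 := by
    have := Real.exp_bound' (x := 0.2446) (by norm_num) (by norm_num) (n := 4) (by norm_num)
    simp only [Finset.sum_range_succ, Finset.sum_range_zero, Nat.factorial] at this
    norm_num at this
    linarith
  have h4 : Real.exp 2 * Real.exp 0.2446 ≤ 2.7182818286 ^ 2 * 1.2772 :=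
    mul_le_mul h2 h3 (Real.exp_pos _).le (by positivity)
  linarith [h1, h4, show (2.7182818286 : ℝ) ^ 2 * 1.2772 ≤ 9.44 by norm_num]

/-- **Theorem 2 in the trivial range.** If `(log N)³ ≤ 300 (log t)²` (i.e. `log N ≤ 300 λ²`,
`λ = log t/log N`), then `‖∑_{N<n≤R} (n+u)^{-it}‖ ≤ N ≤ 9.44 N^{1 − (log N)²/(133.66 (log t)²)}`.
[cite: Ford2002, §5, (5.15) and the display following it] -/
theorem expSum_bound_trivial_range {N R₀ : ℕ} {t u : ℝ} (hN : 1 ≤ N) (hR : R₀ ≤ 2 * N)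
    (hu0 : 0 < u) (ht : 1 < t) (hsmall : Real.log N ^ 3 ≤ 300 * Real.log t ^ 2) :
    ‖∑ n ∈ Ioc N R₀, ((n : ℂ) + u) ^ (-(t * Complex.I))‖
      ≤ 9.44 * (N : ℝ) ^ (1 - Real.log N ^ 2 / (133.66 * Real.log t ^ 2)) := by
  have hS := norm_shifted_sum_le_trivial hR hu0 (t := t)
  have hN0 : (0 : ℝ) < N := by exact_mod_cast hN
  have hN1 : (1 : ℝ) ≤ N := by exact_mod_cast hN
  have hlogt : 0 < Real.log t := Real.log_pos ht
  set d : ℝ := Real.log N ^ 2 / (133.66 * Real.log t ^ 2) with hd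
  have hd0 : 0 ≤ d := by positivity
  -- `N^d ≤ 9.44`
  have hNd : (N : ℝ) ^ d ≤ 9.44 := by
    rw [Real.rpow_def_of_pos hN0]
    refine le_trans (Real.exp_le_exp.2 ?_) exp_300_div_le
    have e : Real.log N * (Real.log N ^ 2 / (133.66 * Real.log t ^ 2)) * 133.66
        = Real.log N ^ 3 / Real.log t ^ 2 := by
      field_simp
    rw [hd, le_div_iff₀ (by norm_num), e, div_le_iff₀ (by positivity)]
    linarith
  have hsplit : (N : ℝ) = (N : ℝ) ^ d * (N : ℝ) ^ (1 - d) := by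
    rw [← Real.rpow_add hN0]; simp
  calc ‖∑ n ∈ Ioc N R₀, ((n : ℂ) + u) ^ (-(t * Complex.I))‖ ≤ N := hS
    _ = (N : ℝ) ^ d * (N : ℝ) ^ (1 - d) := hsplit
    _ ≤ 9.44 * (N : ℝ) ^ (1 - d) := mul_le_mul_of_nonneg_right hNd (by positivity)

end FordVK
end Literature.NumberTheory.LFunctions
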